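import Literature.MathematicalPhysics.QuantumLattice.FermiRG.FKTLaddersResectorizationCore
import HarnessLib

/-!
# Feldman–Knörrer–Trubowitz, *Particle–Hole Ladders*: Lemma II.16 for the all-position component, every `δ⃗`

Theorem companion of `FKTLaddersSec1.lean` (F7a, frozen; untouched) and `FKTLaddersResectorizationCore`
(the `δ⃗ = 0` core) for the cell `gate-hubbard-kl` (seat hubbard-kl-t11; dag g6 record «F7h: δ⃗ ≠ 0
components of F-075», 2026-08-26).  Source: J. Feldman, H. Knörrer, E. Trubowitz, *Particle–Hole
Ladders*, Commun. Math. Phys. **247** (2004) 179–194, arXiv:math-ph/0209044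
[FeldmanKnorrerTrubowitz2004Ladders], Lemma II.16 (`\lemLADresectornorm`) and its proof p.13 L37–114
(locators = chunk/line of the materialised arXiv TeX, as in F7a).  The tree's named fact
`FKTLadders.ResectorizationNormBound` (licence F-075) is NOT discharged here.

## What is proved

The printed proof treats "the case `i₁ = i₂ = i₃ = i₄ = 1`" (all four legs position legs) and says the
other cases are "similar, but easier".  In the tree's encoding the all-position component is the one
WITHOUT derivatives: on a position leg the leg operator of Definition I.12 is multiplication by a
coordinate, so `D^{δ_l}_{0;1} D^{δ_c}_{μ;μ'} D^{δ_r}_{2;3}` acts on that component as multiplication by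
`(x₀-x₁)^{δ_l}(x_μ-x_{μ'})^{δ_c}(x₂-x₃)^{δ_r}` (`diffDecay_triple_of_pos`), and the printed "Leibniz's
rule" becomes the algebraic splitting `x_ν - x_{ν'} = (x_ν - x'_ν) + (x'_ν - x'_{ν'}) + (x'_{ν'} - x_{ν'})`.
We bound `|(u+v+w)^δ| ≤ 3^{|δ|} Σ_σ |u^{δ|_{σ=0}}| |v^{δ|_{σ=1}}| |w^{δ|_{σ=2}}|` over the `27` choice
functions `σ` (`abs_monomial_add_add_le`; only an upper bound is needed, no multinomial theorem), so
each differential–decay factor splits into kernel weights `x^{β}` on the two legs and a weight on `f`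
(`abs_pairWeight_le`, `legIdx` = the printed `β_ν = β_{ν,l} + β_{ν,c} + β_{ν,r}`).  Each of the `27³`
pieces is a leg-wise convolution majorant of the core file with kernels `x^{β_ν} χ̂_{s_ν}` and the
weighted function `(x'₀-x'₁)^{α_l}(x'_μ-x'_{μ'})^{α_c}(x'₂-x'₃)^{α_r} f` (`enorm_pairWeight_mul_convTerm_le`,
the printed display p.13 L58–72); Step 3 of the core file (Tonelli + translation invariance) bounds
its slice integral by `∏_ν ‖x^{β_ν} χ̂_{s_ν}‖_{L¹} · ‖f|_i‖^{(α⃗)}_{Σ_ℓ',Σ_r'}`, `ChiDecayBound` gives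
`‖x^β χ̂_s‖_{L¹} ≤ β! cst M^{(j-1)|β|}` ((II.5)), and the power counting of p.13 L86–106
(`powerCount_le`: `Σ_ν j_ν|β_ν| + ℓ'|α_l| + |α_c| max(ℓ',r') + r'|α_r| ≤ ℓ|δ_l| + |δ_c| max(ℓ,r) + r|δ_r|`)
turns the kernel weights into the scale factors of Definition II.13.  Result
(`scaledLegNorm_resectFour_allPos_le`): for `1 ≤ ℓ' ≤ ℓ`, `1 ≤ r' ≤ r`, `δ_l + δ_c + δ_r ∈ Δ`, `M ≥ 1`,
`M^{-E(ℓ,r;δ⃗)} ‖(f_{Σ_ℓ,Σ_r})|_i‖^{(δ⃗)}_{Σ_ℓ,Σ_r} ≤ 3^{13+|δ⃗|} (δ⃗!)⁴ max(1,cst)⁴ · max_{α⃗ ≤ δ⃗} M^{-E(ℓ',r';α⃗)} ‖f|_i‖^{(α⃗)}_{Σ_ℓ',Σ_r'}`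
with `E(ℓ,r;δ⃗) = ℓ|δ_l| + |δ_c| max(ℓ,r) + r|δ_r|`, i.e. the all-position summand of
`|f|^{[δ⃗]}_{ℓ,r} ≤ const |f|^{[δ⃗]}_{ℓ',r'}` with a constant depending only on `δ⃗` and `cst` (uniform in
`M` and the scales, as printed).

## Hypotheses, and what is NOT here

As in the core file: measurability of the component in its continuous arguments (Tonelli), and the
sector geometry as a neighbour map `N` (at most three old labels per leg and new label) outside of
which the summands `resectTerm` vanish — the label sum is cut BEFORE the weights are applied, so the
same hypothesis serves every `δ⃗`.  The components with momentum legs at `δ⃗ ≠ 0` involve `lineDeriv`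
through the resectorization integral (differentiation under the integral sign, junk values where the
function is not differentiable) and are not treated; hence no statement about `fourNormCoeff` /
`scaledNormMax` at `δ⃗ ≠ 0` is made.  With the sector count of
`FKTLaddersSectorCounting` the neighbour map is instantiated (`scaledLegNorm_resectFour_allPos_le_of_support`,
only the support-vanishing input left, as in the core file); §F `lintegral_slice_le_legNorm_zero`,
`integrable_slice_of_legNorm_zero_ne_top` (finite `(0,0,0)`-norm of the component ⇒ every slice integrable) and
the guarded form `scaledLegNorm_resectFour_allPos_le_of_support'`.  Helper definitions `sel`, `pairWeight`, `legIdx` are functions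
(no named fact is introduced, D-0026); no `instance`, no `notation`; nothing about the Hubbard model is
asserted.
-/

noncomputable section

open MeasureTheory
open scoped ENNReal

namespace Literature.MathematicalPhysics.QuantumLattice.FermiRG

namespace FKTLadders

/-! ### §A Algebra: coordinates, monomials, and the differential–decay operators on position legs -/

/-- The coordinate functions are additive. [cite: FeldmanKnorrerTrubowitz2004Ladders, §I.5 (p.6 L129–133)] -/
theorem coord_add (c : Fin 3) (a b : SpT) : coord c (a + b) = coord c a + coord c b := by
  unfold coord
  split_ifs <;> simp

/-- The coordinate functions commute with negation. [cite: FeldmanKnorrerTrubowitz2004Ladders, §I.5 (p.6 L129–133)] -/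
theorem coord_neg (c : Fin 3) (a : SpT) : coord c (-a) = -coord c a := by
  unfold coord
  split_ifs <;> simp

/-- The coordinate functions are subtractive. [cite: FeldmanKnorrerTrubowitz2004Ladders, §I.5 (p.6 L129–133)] -/
theorem coord_sub (c : Fin 3) (a b : SpT) : coord c (a - b) = coord c a - coord c b := by
  rw [sub_eq_add_neg, coord_add, coord_neg, sub_eq_add_neg]

/-- The coordinate functions are homogeneous. [cite: FeldmanKnorrerTrubowitz2004Ladders, §I.5 (p.6 L129–133)] -/
theorem coord_smul (c : Fin 3) (r : ℝ) (a : SpT) : coord c (r • a) = r * coord c a := by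
  unfold coord
  split_ifs <;> simp

/-- `|x^δ|` is the product of the powers of the absolute coordinates.
[cite: FeldmanKnorrerTrubowitz2004Ladders, §I.5 (p.6 L129–133)] -/
theorem abs_monomial (δ : Fin 3 → ℕ) (x : SpT) : |monomial δ x| = ∏ c, |coord c x| ^ δ c := by
  unfold monomial
  rw [Finset.abs_prod]
  exact Finset.prod_congr rfl fun c _ => abs_pow _ _

/-- `|(±x)^δ| = |x^δ|`. [cite: FeldmanKnorrerTrubowitz2004Ladders, §I.5 (p.6 L129–133)] -/
theorem abs_monomial_smul_of_sq_eq_one (δ : Fin 3 → ℕ) {σ : ℝ} (hσ : σ = 1 ∨ σ = -1) (x : SpT) :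
    |monomial δ (σ • x)| = |monomial δ x| := by
  rw [abs_monomial, abs_monomial]
  refine Finset.prod_congr rfl fun c _ => ?_
  rw [coord_smul, abs_mul]
  rcases hσ with h | h <;> simp [h]

/-- `|(-x)^δ| = |x^δ|`. [cite: FeldmanKnorrerTrubowitz2004Ladders, §I.5 (p.6 L129–133)] -/
theorem abs_monomial_neg (δ : Fin 3 → ℕ) (x : SpT) : |monomial δ (-x)| = |monomial δ x| := by
  have h := abs_monomial_smul_of_sq_eq_one δ (σ := -1) (Or.inr rfl) x
  simpa using h

/-- The monomial with the zero multi-index is `1`. [cite: FeldmanKnorrerTrubowitz2004Ladders, §I.5 (p.6 L129–133)] -/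
theorem monomial_zero_index (x : SpT) : monomial 0 x = 1 := by
  simp [monomial]

/-- `|a+b+c|^n ≤ 3^n (|a|^n + |b|^n + |c|^n)` (via the maximum). [folklore] -/
private theorem abs_add_three_pow_le (a b c : ℝ) (n : ℕ) :
    |a + b + c| ^ n ≤ 3 ^ n * (|a| ^ n + |b| ^ n + |c| ^ n) := by
  have ha := pow_nonneg (abs_nonneg a) n
  have hb := pow_nonneg (abs_nonneg b) n
  have hc := pow_nonneg (abs_nonneg c) n
  set M := max |a| (max |b| |c|) with hM
  have hsum : |a + b + c| ≤ 3 * M := by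
    have h1 : |a| ≤ M := le_max_left _ _
    have h2 : |b| ≤ M := (le_max_left _ _).trans (le_max_right _ _)
    have h3 : |c| ≤ M := (le_max_right _ _).trans (le_max_right _ _)
    calc |a + b + c| ≤ |a + b| + |c| := abs_add_le _ _
      _ ≤ |a| + |b| + |c| := by have := abs_add_le a b; linarith
      _ ≤ 3 * M := by linarith
  have hMle : M ^ n ≤ |a| ^ n + |b| ^ n + |c| ^ n := by
    rcases max_choice |a| (max |b| |c|) with h | h
    · rw [hM, h]; linarith
    · rcases max_choice |b| |c| with h' | h'
      · rw [hM, h, h']; linarith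
      · rw [hM, h, h']; linarith
  calc |a + b + c| ^ n ≤ (3 * M) ^ n := pow_le_pow_left₀ (abs_nonneg _) hsum n
    _ = 3 ^ n * M ^ n := mul_pow _ _ _
    _ ≤ 3 ^ n * (|a| ^ n + |b| ^ n + |c| ^ n) := by gcongr

/-- The part of a multi-index selected by a choice function: `δ|_{σ = j}` keeps `δ c` where `σ c = j`
and is `0` elsewhere; summing over `j` recovers `δ`. [cite: FeldmanKnorrerTrubowitz2004Ladders, Lemma II.16, proof (p.13 L73–85)] -/
theorem sum_select_eq (δ : Fin 3 → ℕ) (σ : Fin 3 → Fin 3) :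
    ((fun c => if σ c = 0 then δ c else 0) + (fun c => if σ c = 1 then δ c else 0) +
      fun c => if σ c = 2 then δ c else 0) = δ := by
  funext c
  simp only [Pi.add_apply]
  have : σ c = 0 ∨ σ c = 1 ∨ σ c = 2 := by omega
  rcases this with h | h | h <;> simp [h]

/-- **The splitting behind "Leibniz's rule" (p.13 L54), as an inequality.**  For
`x_a - x_b = u + v + w` (`u = x_a - x'_a`, `v = x'_a - x'_b`, `w = x'_b - x_b`),
`|(u+v+w)^δ| ≤ 3^{|δ|} Σ_σ |u^{δ|_{σ=0}}| |v^{δ|_{σ=1}}| |w^{δ|_{σ=2}}|`, the sum over the `27` choice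
functions `σ : {coordinates} → {u, v, w}` (coordinatewise `|s+t+r|^n ≤ 3^n (|s|^n + |t|^n + |r|^n)`,
then the product over the coordinates is distributed).  This replaces the multinomial expansion of the
printed proof; only an upper bound is needed. [cite: FeldmanKnorrerTrubowitz2004Ladders, Lemma II.16, proof (p.13 L54–85)] -/
theorem abs_monomial_add_add_le (δ : Fin 3 → ℕ) (u v w : SpT) :
    |monomial δ (u + v + w)| ≤ 3 ^ multiDeg δ * ∑ σ : Fin 3 → Fin 3,
      |monomial (fun c => if σ c = 0 then δ c else 0) u| *
        |monomial (fun c => if σ c = 1 then δ c else 0) v| *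
          |monomial (fun c => if σ c = 2 then δ c else 0) w| := by
  -- the three candidate factors per coordinate
  set T : Fin 3 → Fin 3 → ℝ := fun c j =>
    if j = 0 then |coord c u| ^ δ c else if j = 1 then |coord c v| ^ δ c else |coord c w| ^ δ c with hT
  have hT0 : ∀ c j, 0 ≤ T c j := by
    intro c j; simp only [hT]; split_ifs <;> positivity
  -- coordinatewise bound
  have hcoord : ∀ c : Fin 3, |coord c (u + v + w)| ^ δ c ≤ 3 ^ δ c * ∑ j : Fin 3, T c j := by
    intro c
    rw [coord_add, coord_add]
    refine (abs_add_three_pow_le _ _ _ _).trans (le_of_eq ?_)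
    congr 1
    simp [hT, Fin.sum_univ_three]
  calc |monomial δ (u + v + w)| = ∏ c, |coord c (u + v + w)| ^ δ c := abs_monomial _ _
    _ ≤ ∏ c, (3 ^ δ c * ∑ j : Fin 3, T c j) :=
        Finset.prod_le_prod (fun c _ => by positivity) fun c _ => hcoord c
    _ = 3 ^ multiDeg δ * ∏ c, ∑ j : Fin 3, T c j := by
        rw [Finset.prod_mul_distrib, Finset.prod_pow_eq_pow_sum]
        rfl
    _ = 3 ^ multiDeg δ * ∑ σ : Fin 3 → Fin 3, ∏ c, T c (σ c) := by
        rw [Finset.prod_univ_sum, Fintype.piFinset_univ]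
    _ = _ := by
        congr 1
        refine Finset.sum_congr rfl fun σ _ => ?_
        rw [abs_monomial, abs_monomial, abs_monomial, ← Finset.prod_mul_distrib,
          ← Finset.prod_mul_distrib]
        refine Finset.prod_congr rfl fun c _ => ?_
        have : σ c = 0 ∨ σ c = 1 ∨ σ c = 2 := by omega
        rcases this with h | h | h <;> simp [hT, h]

/-- `Δ` is closed downwards. [cite: FeldmanKnorrerTrubowitz2004Ladders, (II.4) (p.12 L142–149)] -/
theorem mem_DeltaSet_of_le {re r0 : ℕ} {β δ : Fin 3 → ℕ} (h : β ≤ δ) (hδ : δ ∈ DeltaSet re r0) :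
    β ∈ DeltaSet re r0 := by
  simp only [DeltaSet, Set.mem_setOf_eq] at hδ ⊢
  exact ⟨(h 0).trans hδ.1, (Nat.add_le_add (h 1) (h 2)).trans hδ.2⟩

/-- `δ!` is monotone in `δ`. [cite: FeldmanKnorrerTrubowitz2004Ladders, §I.5 (p.6 L131)] -/
theorem multiFactorial_le_of_le {β δ : Fin 3 → ℕ} (h : β ≤ δ) :
    multiFactorial β ≤ multiFactorial δ := by
  unfold multiFactorial
  exact Finset.prod_le_prod' fun c _ => Nat.factorial_le (h c)

/-- `δ!` is positive. [cite: FeldmanKnorrerTrubowitz2004Ladders, §I.5 (p.6 L131)] -/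
theorem multiFactorial_pos (δ : Fin 3 → ℕ) : 0 < multiFactorial δ := by
  unfold multiFactorial
  exact Finset.prod_pos fun c _ => Nat.factorial_pos _

/-- `|δ|` is monotone in `δ`. [cite: FeldmanKnorrerTrubowitz2004Ladders, §I.5 (p.6 L131)] -/
theorem multiDeg_le_of_le {β δ : Fin 3 → ℕ} (h : β ≤ δ) : multiDeg β ≤ multiDeg δ := by
  unfold multiDeg
  exact Finset.sum_le_sum fun c _ => h c

/-- `|·|` is additive. [cite: FeldmanKnorrerTrubowitz2004Ladders, §I.5 (p.6 L131)] -/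
theorem multiDeg_add (β δ : Fin 3 → ℕ) : multiDeg (β + δ) = multiDeg β + multiDeg δ := by
  unfold multiDeg
  simp [Finset.sum_add_distrib]

/-- A selected part of a multi-index is at most the multi-index.
[cite: FeldmanKnorrerTrubowitz2004Ladders, Lemma II.16, proof (p.13 L73–85)] -/
theorem select_le (δ : Fin 3 → ℕ) (σ : Fin 3 → Fin 3) (j : Fin 3) :
    (fun c => if σ c = j then δ c else 0) ≤ δ := by
  intro c
  dsimp only
  split_ifs <;> omega

/-- On a position leg the leg operator is multiplication by the coordinate (Definition I.12 (i)).
[cite: FeldmanKnorrerTrubowitz2004Ladders, Definition I.12 (i) (p.7 L1–20)] -/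
theorem legOp_of_pos (i : LegKind) (μ : Fin 4) (hμ : i μ = 1) (c : Fin 3)
    (g : (Fin 4 → SpT) → ℂ) : legOp i μ c g = fun y => (coord c (y μ) : ℂ) * g y := by
  funext y
  unfold legOp
  rw [if_neg (by rw [hμ]; decide)]

/-- Iterating a multiplication operator multiplies by the power. [folklore] -/
private theorem iterate_mul_fun (a : (Fin 4 → SpT) → ℂ) (n : ℕ) (g : (Fin 4 → SpT) → ℂ) :
    (fun (g : (Fin 4 → SpT) → ℂ) (y : Fin 4 → SpT) => a y * g y)^[n] g =
      fun y => a y ^ n * g y := by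
  induction n generalizing g with
  | zero => funext y; simp
  | succ n ih =>
      rw [Function.iterate_succ, Function.comp_apply, ih]
      funext y
      ring

/-- **On two position legs the differential–decay operator is multiplication by the monomial of the
position difference**: `D^δ_{μ;μ'} g = (x_μ - x_{μ'})^δ g` (Definition I.12 with both legs in
`𝔜_{1,Σ}`; no derivative occurs). [cite: FeldmanKnorrerTrubowitz2004Ladders, Definition I.12 (p.7 L21–41)] -/
theorem diffDecay_of_pos (i : LegKind) (μ μ' : Fin 4) (hμ : i μ = 1) (hμ' : i μ' = 1)
    (δ : Fin 3 → ℕ) (g : (Fin 4 → SpT) → ℂ) :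
    diffDecay i μ μ' δ g = fun y => (monomial δ (y μ - y μ') : ℂ) * g y := by
  have hL : ∀ c : Fin 3, (fun g : (Fin 4 → SpT) → ℂ => legOp i μ c g - legOp i μ' c g) =
      fun (g : (Fin 4 → SpT) → ℂ) (y : Fin 4 → SpT) => (coord c (y μ - y μ') : ℂ) * g y := by
    intro c
    funext g y
    rw [legOp_of_pos i μ hμ, legOp_of_pos i μ' hμ']
    simp only [Pi.sub_apply]
    rw [coord_sub]
    push_cast
    ring
  unfold diffDecay
  rw [hL 0, hL 1, hL 2, iterate_mul_fun, iterate_mul_fun, iterate_mul_fun]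
  funext y
  simp only [monomial, Fin.prod_univ_three]
  push_cast
  ring

/-- Hence, for a leg-kind vector whose legs `0,1`, `μ,μ'`, `2,3` are position legs, the triple operator
of Definition I.13 (i) is multiplication by
`(x₀-x₁)^{δ_l} (x_μ-x_{μ'})^{δ_c} (x₂-x₃)^{δ_r}`. [cite: FeldmanKnorrerTrubowitz2004Ladders, Definition I.13 (i) (p.7 L43–59)] -/
theorem diffDecay_triple_of_pos (i : LegKind) (h0 : i 0 = 1) (h1 : i 1 = 1) (h2 : i 2 = 1)
    (h3 : i 3 = 1) (μ μ' : Fin 4) (hμ : i μ = 1) (hμ' : i μ' = 1) (δl δc δr : Fin 3 → ℕ)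
    (g : (Fin 4 → SpT) → ℂ) :
    diffDecay i 0 1 δl (diffDecay i μ μ' δc (diffDecay i 2 3 δr g)) = fun y =>
      ((monomial δl (y 0 - y 1) * monomial δc (y μ - y μ') * monomial δr (y 2 - y 3) : ℝ) : ℂ) *
        g y := by
  rw [diffDecay_of_pos i 2 3 h2 h3, diffDecay_of_pos i μ μ' hμ hμ', diffDecay_of_pos i 0 1 h0 h1]
  funext y
  push_cast
  ring


/-! ### §B The weights of the all-position component and their splitting -/

/-- `x^{β+β'} = x^β x^{β'}`. [cite: FeldmanKnorrerTrubowitz2004Ladders, §I.5 (p.6 L129–133)] -/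
theorem monomial_add_index (β β' : Fin 3 → ℕ) (x : SpT) :
    monomial (β + β') x = monomial β x * monomial β' x := by
  unfold monomial
  rw [← Finset.prod_mul_distrib]
  exact Finset.prod_congr rfl fun c _ => by rw [Pi.add_apply, pow_add]

/-- `|0^β| ≤ 1`. [cite: FeldmanKnorrerTrubowitz2004Ladders, §I.5 (p.6 L129–133)] -/
theorem abs_monomial_zero_le_one (β : Fin 3 → ℕ) : |monomial β (0 : SpT)| ≤ 1 := by
  rw [abs_monomial]
  refine Finset.prod_le_one (fun c _ => by positivity) fun c _ => ?_
  have : coord c (0 : SpT) = 0 := by unfold coord; split_ifs <;> simp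
  rw [this, abs_zero]
  exact pow_le_one₀ le_rfl zero_le_one

/-- The selection `δ|_{σ = j}` of a multi-index by a choice function (see `sum_select_eq`).
[cite: FeldmanKnorrerTrubowitz2004Ladders, Lemma II.16, proof (p.13 L73–85)] -/
def sel (δ : Fin 3 → ℕ) (σ : Fin 3 → Fin 3) (j : Fin 3) : Fin 3 → ℕ :=
  fun c => if σ c = j then δ c else 0

/-- `δ|_{σ=j} ≤ δ`. [cite: FeldmanKnorrerTrubowitz2004Ladders, Lemma II.16, proof (p.13 L73–85)] -/
theorem sel_le (δ : Fin 3 → ℕ) (σ : Fin 3 → Fin 3) (j : Fin 3) : sel δ σ j ≤ δ :=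
  select_le δ σ j

/-- `δ|_{σ=0} + δ|_{σ=1} + δ|_{σ=2} = δ`. [cite: FeldmanKnorrerTrubowitz2004Ladders, Lemma II.16, proof (p.13 L73–85)] -/
theorem sel_sum (δ : Fin 3 → ℕ) (σ : Fin 3 → Fin 3) : sel δ σ 0 + sel δ σ 1 + sel δ σ 2 = δ :=
  sum_select_eq δ σ

/-- The weight `(x₀-x₁)^{α_l} (x_μ-x_{μ'})^{α_c} (x₂-x₃)^{α_r}` by which the triple differential–decay
operator of Definition I.13 (i) acts on the all-position component (`diffDecay_triple_of_pos`).
[cite: FeldmanKnorrerTrubowitz2004Ladders, Definition I.13 (i) (p.7 L43–59)] -/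
def pairWeight (αl αc αr : Fin 3 → ℕ) (μ μ' : Fin 4) (x : Fin 4 → SpT) : ℝ :=
  monomial αl (x 0 - x 1) * monomial αc (x μ - x μ') * monomial αr (x 2 - x 3)

/-- The multi-index `β_ν = β_{ν,l} + β_{ν,c} + β_{ν,r}` carried by the resectorization kernel of leg `ν`
in the term of the splitting labelled by the choice functions `σ_l, σ_c, σ_r` (p.13 L73–85: `β_{1,l}`
and `β_{2,l}` come from `D_{1;2}^{δ_l}`, `β_{μ,c}`, `β_{μ',c}` from `D_{μ;μ'}^{δ_c}`, `β_{3,r}`, `β_{4,r}`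
from `D_{3;4}^{δ_r}`; legs `0,…,3` here). [cite: FeldmanKnorrerTrubowitz2004Ladders, Lemma II.16, proof (p.13 L73–85)] -/
def legIdx (δl δc δr : Fin 3 → ℕ) (μ μ' : Fin 4) (σl σc σr : Fin 3 → Fin 3) (ν : Fin 4) :
    Fin 3 → ℕ :=
  (if ν = 0 then sel δl σl 0 else 0) + (if ν = 1 then sel δl σl 2 else 0) +
    (if ν = μ then sel δc σc 0 else 0) + (if ν = μ' then sel δc σc 2 else 0) +
    (if ν = 2 then sel δr σr 0 else 0) + (if ν = 3 then sel δr σr 2 else 0)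

/-- Regrouping the six kernel-side factors of the splitting leg by leg.
[cite: FeldmanKnorrerTrubowitz2004Ladders, Lemma II.16, proof (p.13 L73–85)] -/
theorem prod_abs_monomial_legIdx (δl δc δr : Fin 3 → ℕ) {μ μ' : Fin 4} (hμ : μ = 0 ∨ μ = 1)
    (hμ' : μ' = 2 ∨ μ' = 3) (σl σc σr : Fin 3 → Fin 3) (e : Fin 4 → SpT) :
    ∏ ν : Fin 4, |monomial (legIdx δl δc δr μ μ' σl σc σr ν) (e ν)| =
      |monomial (sel δl σl 0) (e 0)| * |monomial (sel δl σl 2) (e 1)| *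
        (|monomial (sel δc σc 0) (e μ)| * |monomial (sel δc σc 2) (e μ')|) *
        (|monomial (sel δr σr 0) (e 2)| * |monomial (sel δr σr 2) (e 3)|) := by
  simp only [Fin.prod_univ_four, legIdx]
  rcases hμ with rfl | rfl <;> rcases hμ' with rfl | rfl <;>
    simp [monomial_add_index, abs_mul] <;> ring

/-- **The splitting of the weight (p.13 L54–85), as an inequality.**  With `x = y`, `x' = y - e`
(`e` = the kernel variables, extended by zero to the untouched legs):
`|(y₀-y₁)^{δ_l}(y_μ-y_{μ'})^{δ_c}(y₂-y₃)^{δ_r}| ≤ 3^{|δ_l|+|δ_c|+|δ_r|} Σ_{σ_l,σ_c,σ_r}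
(∏_ν |e_ν^{β_ν}|) · |(x'₀-x'₁)^{α_l}(x'_μ-x'_{μ'})^{α_c}(x'₂-x'₃)^{α_r}|` with `β_ν = legIdx … ν` and
`α_• = δ_•|_{σ_•=1}`. [cite: FeldmanKnorrerTrubowitz2004Ladders, Lemma II.16, proof (p.13 L54–85)] -/
theorem abs_pairWeight_le (δl δc δr : Fin 3 → ℕ) {μ μ' : Fin 4} (hμ : μ = 0 ∨ μ = 1)
    (hμ' : μ' = 2 ∨ μ' = 3) (y e : Fin 4 → SpT) :
    |pairWeight δl δc δr μ μ' y| ≤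
      3 ^ (multiDeg δl + multiDeg δc + multiDeg δr) *
        ∑ σl : Fin 3 → Fin 3, ∑ σc : Fin 3 → Fin 3, ∑ σr : Fin 3 → Fin 3,
          (∏ ν : Fin 4, |monomial (legIdx δl δc δr μ μ' σl σc σr ν) (e ν)|) *
            |pairWeight (sel δl σl 1) (sel δc σc 1) (sel δr σr 1) μ μ' (y - e)| := by
  have hsplit : ∀ a b : Fin 4, y a - y b = e a + ((y - e) a - (y - e) b) + -(e b) := by
    intro a b
    simp only [Pi.sub_apply]
    abel
  -- the three factor bounds
  have hl := abs_monomial_add_add_le δl (e 0) ((y - e) 0 - (y - e) 1) (-(e 1))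
  have hc := abs_monomial_add_add_le δc (e μ) ((y - e) μ - (y - e) μ') (-(e μ'))
  have hr := abs_monomial_add_add_le δr (e 2) ((y - e) 2 - (y - e) 3) (-(e 3))
  rw [← hsplit] at hl hc hr
  simp only [abs_monomial_neg] at hl hc hr
  have h0l : 0 ≤ |monomial δl (y 0 - y 1)| := abs_nonneg _
  have h0c : 0 ≤ |monomial δc (y μ - y μ')| := abs_nonneg _
  have h0r : 0 ≤ |monomial δr (y 2 - y 3)| := abs_nonneg _
  unfold pairWeight
  rw [abs_mul, abs_mul]
  calc |monomial δl (y 0 - y 1)| * |monomial δc (y μ - y μ')| * |monomial δr (y 2 - y 3)|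
      ≤ (3 ^ multiDeg δl * ∑ σ : Fin 3 → Fin 3,
            |monomial (fun c => if σ c = 0 then δl c else 0) (e 0)| *
            |monomial (fun c => if σ c = 1 then δl c else 0) ((y - e) 0 - (y - e) 1)| *
            |monomial (fun c => if σ c = 2 then δl c else 0) (e 1)|) *
        (3 ^ multiDeg δc * ∑ σ : Fin 3 → Fin 3,
            |monomial (fun c => if σ c = 0 then δc c else 0) (e μ)| *
            |monomial (fun c => if σ c = 1 then δc c else 0) ((y - e) μ - (y - e) μ')| *
            |monomial (fun c => if σ c = 2 then δc c else 0) (e μ')|) *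
        (3 ^ multiDeg δr * ∑ σ : Fin 3 → Fin 3,
            |monomial (fun c => if σ c = 0 then δr c else 0) (e 2)| *
            |monomial (fun c => if σ c = 1 then δr c else 0) ((y - e) 2 - (y - e) 3)| *
            |monomial (fun c => if σ c = 2 then δr c else 0) (e 3)|) :=
        mul_le_mul (mul_le_mul hl hc h0c (h0l.trans hl)) hr h0r
          (mul_nonneg (h0l.trans hl) (h0c.trans hc))
    _ = 3 ^ (multiDeg δl + multiDeg δc + multiDeg δr) *
          ((∑ σ : Fin 3 → Fin 3,
            |monomial (fun c => if σ c = 0 then δl c else 0) (e 0)| *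
            |monomial (fun c => if σ c = 1 then δl c else 0) ((y - e) 0 - (y - e) 1)| *
            |monomial (fun c => if σ c = 2 then δl c else 0) (e 1)|) *
          ((∑ σ : Fin 3 → Fin 3,
            |monomial (fun c => if σ c = 0 then δc c else 0) (e μ)| *
            |monomial (fun c => if σ c = 1 then δc c else 0) ((y - e) μ - (y - e) μ')| *
            |monomial (fun c => if σ c = 2 then δc c else 0) (e μ')|) *
          (∑ σ : Fin 3 → Fin 3,
            |monomial (fun c => if σ c = 0 then δr c else 0) (e 2)| *
            |monomial (fun c => if σ c = 1 then δr c else 0) ((y - e) 2 - (y - e) 3)| *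
            |monomial (fun c => if σ c = 2 then δr c else 0) (e 3)|))) := by
        rw [pow_add, pow_add]
        ring
    _ = _ := by
        congr 1
        rw [Finset.sum_mul_sum, Finset.sum_mul_sum]
        refine Finset.sum_congr rfl fun σl _ => Finset.sum_congr rfl fun σc _ => ?_
        rw [Finset.mul_sum]
        refine Finset.sum_congr rfl fun σr _ => ?_
        rw [prod_abs_monomial_legIdx δl δc δr hμ hμ' σl σc σr e]
        unfold sel
        simp only [abs_mul, Pi.sub_apply]
        ring


/-! ### §C The weighted Step 1: `|(weight) · convTerm| ≤ 3^{|δ⃗|} Σ_σ convMajor(weighted kernels, weighted g)` -/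

/-- The coordinate functions are continuous. [cite: FeldmanKnorrerTrubowitz2004Ladders, §I.5 (p.6 L129–133)] -/
theorem continuous_coord (c : Fin 3) : Continuous (coord c) := by
  unfold coord
  split_ifs
  · exact continuous_fst
  · exact (continuous_apply _).comp continuous_snd
  · exact (continuous_apply _).comp continuous_snd

/-- Monomials are continuous. [cite: FeldmanKnorrerTrubowitz2004Ladders, §I.5 (p.6 L129–133)] -/
theorem continuous_monomial (δ : Fin 3 → ℕ) : Continuous (monomial δ) := by
  unfold monomial
  exact continuous_finsetProd _ fun c _ => (continuous_coord c).pow _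

/-- The weights `pairWeight` are continuous. [cite: FeldmanKnorrerTrubowitz2004Ladders, Definition I.13 (i) (p.7 L43–59)] -/
theorem continuous_pairWeight (αl αc αr : Fin 3 → ℕ) (μ μ' : Fin 4) :
    Continuous (pairWeight αl αc αr μ μ') := by
  unfold pairWeight
  refine ((?_ : Continuous _).mul ?_).mul ?_
  · exact (continuous_monomial αl).comp ((continuous_apply 0).sub (continuous_apply 1))
  · exact (continuous_monomial αc).comp ((continuous_apply μ).sub (continuous_apply μ'))
  · exact (continuous_monomial αr).comp ((continuous_apply 2).sub (continuous_apply 3))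

/-- `‖(r : ℂ)‖ₑ = ofReal |r|`. [folklore] -/
private theorem enorm_real_eq_ofReal_abs (r : ℝ) : ‖(r : ℂ)‖ₑ = ENNReal.ofReal |r| := by
  rw [enorm_eq_nnnorm, Complex.nnnorm_real, ← enorm_eq_nnnorm, Real.enorm_eq_ofReal_abs]

/-- Extension by zero off `P` is measurable. [folklore] -/
private theorem measurable_extZero' {P : Fin 4 → Prop} [DecidablePred P] :
    Measurable fun (w : {μ : Fin 4 // P μ} → SpT) (μ : Fin 4) =>
      if h : P μ then w ⟨μ, h⟩ else (0 : SpT) := by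
  refine measurable_pi_lambda _ fun μ => ?_
  by_cases h : P μ
  · simp only [dif_pos h]; exact measurable_pi_apply _
  · simp only [dif_neg h]; exact measurable_const

/-- The kernel `w ↦ ∏_μ |K_μ(σ_μ w_μ)|` is measurable. [folklore] -/
private theorem measurable_convKernel' {P : Fin 4 → Prop} [DecidablePred P]
    (K : {μ : Fin 4 // P μ} → SpT → ℂ) (hK : ∀ μ, Measurable (K μ)) (σ : {μ : Fin 4 // P μ} → ℝ) :
    Measurable fun w : {μ : Fin 4 // P μ} → SpT => ∏ μ, ‖K μ (σ μ • w μ)‖ₑ := by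
  refine Finset.measurable_prod _ fun μ _ => ?_
  exact ((hK μ).comp ((measurable_pi_apply μ).const_smul (σ μ))).enorm

/-- Weighted kernels `t ↦ t^β K(t)` are measurable. [cite: FeldmanKnorrerTrubowitz2004Ladders, Lemma II.16, proof (p.13 L58–66)] -/
theorem measurable_monomial_mul {K : SpT → ℂ} (hK : Measurable K) (β : Fin 3 → ℕ) :
    Measurable fun t : SpT => (monomial β t : ℂ) * K t :=
  (Complex.continuous_ofReal.measurable.comp (continuous_monomial β).measurable).mul hK

/-- Weighted functions `x ↦ (weight)(x) g(x)` are measurable. [cite: FeldmanKnorrerTrubowitz2004Ladders, Lemma II.16, proof (p.13 L58–66)] -/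
theorem measurable_pairWeight_mul {g : (Fin 4 → SpT) → ℂ} (hg : Measurable g) (αl αc αr : Fin 3 → ℕ)
    (μ μ' : Fin 4) : Measurable fun x => (pairWeight αl αc αr μ μ' x : ℂ) * g x :=
  (Complex.continuous_ofReal.measurable.comp (continuous_pairWeight αl αc αr μ μ').measurable).mul hg

/-- The kernel-side weight only sees the convolved legs: `∏_ν |e_ν^{β_ν}| ≤ ∏_{μ ∈ P} |w_μ^{β_μ}|` for
`e` = `w` extended by zero (the dropped factors are `|0^{β_ν}| ≤ 1`).
[cite: FeldmanKnorrerTrubowitz2004Ladders, Lemma II.16, proof (p.13 L58–66)] -/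
theorem prod_abs_monomial_extZero_le {P : Fin 4 → Prop} [DecidablePred P] (β : Fin 4 → Fin 3 → ℕ)
    (w : {μ : Fin 4 // P μ} → SpT) :
    ∏ ν : Fin 4, |monomial (β ν) ((fun μ : Fin 4 => if h : P μ then w ⟨μ, h⟩ else (0 : SpT)) ν)| ≤
      ∏ μ : {μ : Fin 4 // P μ}, |monomial (β μ.1) (w μ)| := by
  rw [← Finset.prod_filter_mul_prod_filter_not Finset.univ P]
  have h1 : ∏ ν ∈ Finset.univ.filter P,
      |monomial (β ν) ((fun μ : Fin 4 => if h : P μ then w ⟨μ, h⟩ else (0 : SpT)) ν)| =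
      ∏ μ : {μ : Fin 4 // P μ}, |monomial (β μ.1) (w μ)| := by
    rw [Finset.prod_subtype (Finset.univ.filter P) (p := P) (by simp)]
    refine Finset.prod_congr rfl fun μ _ => ?_
    simp only [dif_pos μ.2]
  have h2 : ∏ ν ∈ Finset.univ.filter (fun ν => ¬ P ν),
      |monomial (β ν) ((fun μ : Fin 4 => if h : P μ then w ⟨μ, h⟩ else (0 : SpT)) ν)| ≤ 1 := by
    refine Finset.prod_le_one (fun ν _ => abs_nonneg _) fun ν hν => ?_
    have hν' : ¬ P ν := (Finset.mem_filter.mp hν).2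
    simp only [dif_neg hν']
    exact abs_monomial_zero_le_one _
  rw [h1]
  exact mul_le_of_le_one_right (Finset.prod_nonneg fun _ _ => abs_nonneg _) h2


/-- **Weighted Step 1.**  For legs `μ ∈ {0,1}`, `μ' ∈ {2,3}` and multi-indices `δ⃗`:
`|(y₀-y₁)^{δ_l}(y_μ-y_{μ'})^{δ_c}(y₂-y₃)^{δ_r} · convTerm(y)| ≤ 3^{|δ⃗|} Σ_{σ_l,σ_c,σ_r} convMajor_σ(y)`,
where the `σ`-th majorant has the kernels `t ↦ t^{β_ν} K_ν(t)` (`β_ν = legIdx … ν`) and the weighted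
function `x ↦ (x₀-x₁)^{α_l}(x_μ-x_{μ'})^{α_c}(x₂-x₃)^{α_r} g(x)` (`α = δ|_{σ=1}`) — the printed
"by Leibniz's rule … bounded by … times the maximum of" display (p.13 L54–72), with the weight moved
inside the majorant of `enorm_convTerm_le_convMajor` and split by `abs_pairWeight_le`.
[cite: FeldmanKnorrerTrubowitz2004Ladders, Lemma II.16, proof (p.13 L54–72)] -/
theorem enorm_pairWeight_mul_convTerm_le {P : Fin 4 → Prop} [DecidablePred P]
    (K : {μ : Fin 4 // P μ} → SpT → ℂ) (hK : ∀ μ, Measurable (K μ))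
    (σ : {μ : Fin 4 // P μ} → ℝ) (hσ : ∀ μ, σ μ = 1 ∨ σ μ = -1)
    (g : (Fin 4 → SpT) → ℂ) (hg : Measurable g)
    (δl δc δr : Fin 3 → ℕ) {μ μ' : Fin 4} (hμ : μ = 0 ∨ μ = 1) (hμ' : μ' = 2 ∨ μ' = 3)
    (y : Fin 4 → SpT) :
    ‖(pairWeight δl δc δr μ μ' y : ℂ) * convTerm P K σ g y‖ₑ ≤
      3 ^ (multiDeg δl + multiDeg δc + multiDeg δr) *
        ∑ σl : Fin 3 → Fin 3, ∑ σc : Fin 3 → Fin 3, ∑ σr : Fin 3 → Fin 3,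
          convMajor P (fun ν t => (monomial (legIdx δl δc δr μ μ' σl σc σr ν.1) t : ℂ) * K ν t) σ
            (fun x => (pairWeight (sel δl σl 1) (sel δc σc 1) (sel δr σr 1) μ μ' x : ℂ) * g x) y := by
  -- abbreviations
  set e : ({μ : Fin 4 // P μ} → SpT) → (Fin 4 → SpT) :=
    fun w μ => if h : P μ then w ⟨μ, h⟩ else 0 with he
  have hem : Measurable e := measurable_extZero'
  set Φ : ({μ : Fin 4 // P μ} → SpT) → ℝ≥0∞ := fun w => ∏ μ, ‖K μ (σ μ • w μ)‖ₑ with hΦ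
  have hΦm : Measurable Φ := measurable_convKernel' K hK σ
  set Kβ : (Fin 3 → Fin 3) → (Fin 3 → Fin 3) → (Fin 3 → Fin 3) → {μ : Fin 4 // P μ} → SpT → ℂ :=
    fun σl σc σr ν t => (monomial (legIdx δl δc δr μ μ' σl σc σr ν.1) t : ℂ) * K ν t with hKβ
  set gα : (Fin 3 → Fin 3) → (Fin 3 → Fin 3) → (Fin 3 → Fin 3) → (Fin 4 → SpT) → ℂ :=
    fun σl σc σr x => (pairWeight (sel δl σl 1) (sel δc σc 1) (sel δr σr 1) μ μ' x : ℂ) * g x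
    with hgα
  -- Step 1 of the core file, then move the weight inside the majorant
  rw [enorm_mul]
  refine (mul_le_mul' le_rfl (enorm_convTerm_le_convMajor K σ g y)).trans ?_
  have hmeas0 : Measurable fun w : {μ : Fin 4 // P μ} → SpT => Φ w * ‖g (y - e w)‖ₑ :=
    hΦm.mul ((hg.comp (measurable_const.sub hem)).enorm)
  have hmeasT : ∀ σl σc σr, Measurable fun w : {μ : Fin 4 // P μ} → SpT =>
      (∏ ν, ‖Kβ σl σc σr ν (σ ν • w ν)‖ₑ) * ‖gα σl σc σr (y - e w)‖ₑ := by
    intro σl σc σr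
    refine (measurable_convKernel' (Kβ σl σc σr) (fun ν => ?_) σ).mul ?_
    · exact measurable_monomial_mul (hK ν) _
    · exact ((measurable_pairWeight_mul hg _ _ _ μ μ').comp (measurable_const.sub hem)).enorm
  -- the pointwise bound inside the `w`-integral
  have hpt : ∀ w : {μ : Fin 4 // P μ} → SpT,
      ‖(pairWeight δl δc δr μ μ' y : ℂ)‖ₑ * (Φ w * ‖g (y - e w)‖ₑ) ≤
        3 ^ (multiDeg δl + multiDeg δc + multiDeg δr) *
          ∑ σl : Fin 3 → Fin 3, ∑ σc : Fin 3 → Fin 3, ∑ σr : Fin 3 → Fin 3,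
            (∏ ν, ‖Kβ σl σc σr ν (σ ν • w ν)‖ₑ) * ‖gα σl σc σr (y - e w)‖ₑ := by
    intro w
    -- the real splitting bound, transported to `ℝ≥0∞`
    have hsplit := abs_pairWeight_le δl δc δr hμ hμ' y (e w)
    have h3 : (0 : ℝ) ≤ 3 ^ (multiDeg δl + multiDeg δc + multiDeg δr) := by positivity
    have hW : ‖(pairWeight δl δc δr μ μ' y : ℂ)‖ₑ ≤
        3 ^ (multiDeg δl + multiDeg δc + multiDeg δr) *
          ∑ σl : Fin 3 → Fin 3, ∑ σc : Fin 3 → Fin 3, ∑ σr : Fin 3 → Fin 3,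
            ENNReal.ofReal (∏ ν : Fin 4, |monomial (legIdx δl δc δr μ μ' σl σc σr ν) (e w ν)|) *
              ENNReal.ofReal
                |pairWeight (sel δl σl 1) (sel δc σc 1) (sel δr σr 1) μ μ' (y - e w)| := by
      rw [enorm_real_eq_ofReal_abs]
      refine (ENNReal.ofReal_le_ofReal hsplit).trans (le_of_eq ?_)
      rw [ENNReal.ofReal_mul h3, ENNReal.ofReal_pow (by norm_num), ENNReal.ofReal_ofNat]
      refine congrArg (fun t : ℝ≥0∞ => (3 : ℝ≥0∞) ^ (multiDeg δl + multiDeg δc + multiDeg δr) * t) ?_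
      rw [ENNReal.ofReal_sum_of_nonneg (fun _ _ => Finset.sum_nonneg fun _ _ =>
        Finset.sum_nonneg fun _ _ => by positivity)]
      refine Finset.sum_congr rfl fun σl _ => ?_
      rw [ENNReal.ofReal_sum_of_nonneg (fun _ _ => Finset.sum_nonneg fun _ _ => by positivity)]
      refine Finset.sum_congr rfl fun σc _ => ?_
      rw [ENNReal.ofReal_sum_of_nonneg (fun _ _ => by positivity)]
      refine Finset.sum_congr rfl fun σr _ => ?_
      exact ENNReal.ofReal_mul (Finset.prod_nonneg fun _ _ => abs_nonneg _)
    -- termwise: kernel weight ≤ weighted kernels, function weight = weighted function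
    have hterm : ∀ σl σc σr : Fin 3 → Fin 3,
        ENNReal.ofReal (∏ ν : Fin 4, |monomial (legIdx δl δc δr μ μ' σl σc σr ν) (e w ν)|) *
            ENNReal.ofReal
              |pairWeight (sel δl σl 1) (sel δc σc 1) (sel δr σr 1) μ μ' (y - e w)| *
          (Φ w * ‖g (y - e w)‖ₑ) ≤
        (∏ ν, ‖Kβ σl σc σr ν (σ ν • w ν)‖ₑ) * ‖gα σl σc σr (y - e w)‖ₑ := by
      intro σl σc σr
      have hA : ENNReal.ofReal (∏ ν : Fin 4, |monomial (legIdx δl δc δr μ μ' σl σc σr ν) (e w ν)|) *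
          Φ w ≤ ∏ ν, ‖Kβ σl σc σr ν (σ ν • w ν)‖ₑ := by
        calc ENNReal.ofReal (∏ ν : Fin 4, |monomial (legIdx δl δc δr μ μ' σl σc σr ν) (e w ν)|) * Φ w
            ≤ ENNReal.ofReal (∏ ν : {μ : Fin 4 // P μ},
                |monomial (legIdx δl δc δr μ μ' σl σc σr ν.1) (w ν)|) * Φ w :=
              mul_le_mul' (ENNReal.ofReal_le_ofReal (prod_abs_monomial_extZero_le _ w)) le_rfl
          _ = (∏ ν : {μ : Fin 4 // P μ},
                ENNReal.ofReal |monomial (legIdx δl δc δr μ μ' σl σc σr ν.1) (w ν)|) * Φ w := by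
              rw [ENNReal.ofReal_prod_of_nonneg fun _ _ => abs_nonneg _]
          _ = ∏ ν, ‖Kβ σl σc σr ν (σ ν • w ν)‖ₑ := by
              rw [hΦ, ← Finset.prod_mul_distrib]
              refine Finset.prod_congr rfl fun ν _ => ?_
              rw [hKβ, enorm_mul, enorm_real_eq_ofReal_abs,
                abs_monomial_smul_of_sq_eq_one _ (hσ ν)]
      have hB : ENNReal.ofReal
            |pairWeight (sel δl σl 1) (sel δc σc 1) (sel δr σr 1) μ μ' (y - e w)| *
          ‖g (y - e w)‖ₑ = ‖gα σl σc σr (y - e w)‖ₑ := by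
        rw [hgα, enorm_mul, enorm_real_eq_ofReal_abs]
      calc _ = (ENNReal.ofReal (∏ ν : Fin 4, |monomial (legIdx δl δc δr μ μ' σl σc σr ν) (e w ν)|) *
              Φ w) * (ENNReal.ofReal |pairWeight (sel δl σl 1) (sel δc σc 1) (sel δr σr 1) μ μ'
                (y - e w)| * ‖g (y - e w)‖ₑ) := by ring
        _ ≤ (∏ ν, ‖Kβ σl σc σr ν (σ ν • w ν)‖ₑ) * ‖gα σl σc σr (y - e w)‖ₑ := by
              rw [← hB]; exact mul_le_mul' hA le_rfl
    calc ‖(pairWeight δl δc δr μ μ' y : ℂ)‖ₑ * (Φ w * ‖g (y - e w)‖ₑ)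
        ≤ (3 ^ (multiDeg δl + multiDeg δc + multiDeg δr) *
            ∑ σl : Fin 3 → Fin 3, ∑ σc : Fin 3 → Fin 3, ∑ σr : Fin 3 → Fin 3,
              ENNReal.ofReal (∏ ν : Fin 4, |monomial (legIdx δl δc δr μ μ' σl σc σr ν) (e w ν)|) *
                ENNReal.ofReal
                  |pairWeight (sel δl σl 1) (sel δc σc 1) (sel δr σr 1) μ μ' (y - e w)|) *
            (Φ w * ‖g (y - e w)‖ₑ) := mul_le_mul' hW le_rfl
      _ = 3 ^ (multiDeg δl + multiDeg δc + multiDeg δr) *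
            ∑ σl : Fin 3 → Fin 3, ∑ σc : Fin 3 → Fin 3, ∑ σr : Fin 3 → Fin 3,
              ENNReal.ofReal (∏ ν : Fin 4, |monomial (legIdx δl δc δr μ μ' σl σc σr ν) (e w ν)|) *
                ENNReal.ofReal
                  |pairWeight (sel δl σl 1) (sel δc σc 1) (sel δr σr 1) μ μ' (y - e w)| *
                (Φ w * ‖g (y - e w)‖ₑ) := by
          rw [mul_assoc]
          refine congrArg (fun t : ℝ≥0∞ => (3 : ℝ≥0∞) ^ (multiDeg δl + multiDeg δc + multiDeg δr) * t) ?_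
          rw [Finset.sum_mul]
          refine Finset.sum_congr rfl fun σl _ => ?_
          rw [Finset.sum_mul]
          refine Finset.sum_congr rfl fun σc _ => ?_
          rw [Finset.sum_mul]
      _ ≤ _ := by
          refine mul_le_mul' le_rfl (Finset.sum_le_sum fun σl _ => Finset.sum_le_sum fun σc _ =>
            Finset.sum_le_sum fun σr _ => hterm σl σc σr)
  -- integrate the pointwise bound
  calc ‖(pairWeight δl δc δr μ μ' y : ℂ)‖ₑ * convMajor P K σ g y
      = ∫⁻ w, ‖(pairWeight δl δc δr μ μ' y : ℂ)‖ₑ * (Φ w * ‖g (y - e w)‖ₑ) := by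
        unfold convMajor
        rw [lintegral_const_mul _ hmeas0]
    _ ≤ ∫⁻ w, 3 ^ (multiDeg δl + multiDeg δc + multiDeg δr) *
          ∑ σl : Fin 3 → Fin 3, ∑ σc : Fin 3 → Fin 3, ∑ σr : Fin 3 → Fin 3,
            (∏ ν, ‖Kβ σl σc σr ν (σ ν • w ν)‖ₑ) * ‖gα σl σc σr (y - e w)‖ₑ :=
        lintegral_mono fun w => hpt w
    _ = 3 ^ (multiDeg δl + multiDeg δc + multiDeg δr) *
          ∑ σl : Fin 3 → Fin 3, ∑ σc : Fin 3 → Fin 3, ∑ σr : Fin 3 → Fin 3,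
            ∫⁻ w, (∏ ν, ‖Kβ σl σc σr ν (σ ν • w ν)‖ₑ) * ‖gα σl σc σr (y - e w)‖ₑ := by
        rw [lintegral_const_mul]
        · refine congrArg (fun t : ℝ≥0∞ => (3 : ℝ≥0∞) ^ (multiDeg δl + multiDeg δc + multiDeg δr) * t) ?_
          rw [lintegral_finsetSum _ fun σl _ => ?_]
          · refine Finset.sum_congr rfl fun σl _ => ?_
            rw [lintegral_finsetSum _ fun σc _ => ?_]
            · refine Finset.sum_congr rfl fun σc _ => ?_
              exact lintegral_finsetSum _ fun σr _ => hmeasT σl σc σr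
            · exact Finset.measurable_sum _ fun σr _ => hmeasT σl σc σr
          · exact Finset.measurable_sum _ fun σc _ => Finset.measurable_sum _ fun σr _ =>
              hmeasT σl σc σr
        · exact Finset.measurable_sum _ fun σl _ => Finset.measurable_sum _ fun σc _ =>
            Finset.measurable_sum _ fun σr _ => hmeasT σl σc σr
    _ = _ := rfl


/-! ### §D Kernel bounds with weights, the power counting of p.13 L86–106, and the assembly -/

/-- `ChiDecayBound` with the weight `x^β`: `∫ |x^β χ̂_s(x)| dx ≤ β! · cst · M^{(j-1)|β|}` for `s ∈ Σ_j`,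
`β ∈ Δ` ((II.5) `\eqnLADchisbnd`). [cite: FeldmanKnorrerTrubowitz2004Ladders, (II.5) (p.13 L91–96)] -/
theorem lintegral_enorm_monomial_chiHat_le {D : LadderData} {cst : ℝ} (hχ : ChiDecayBound D cst)
    {j : ℕ} (hj : 1 ≤ j) {a : Arc} (ha : a ∈ D.Sig j) {β : Fin 3 → ℕ}
    (hβ : β ∈ DeltaSet D.re D.r0) :
    ∫⁻ t, ‖(monomial β t : ℂ) * chiHat (D.χ j a) t‖ₑ ≤
      (multiFactorial β : ℝ≥0∞) * ENNReal.ofReal (cst * D.S.M ^ ((j - 1) * multiDeg β)) := by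
  have h := hχ j hj a ha β hβ
  have h0 : (multiFactorial β : ℝ≥0∞) ≠ 0 := by exact_mod_cast (multiFactorial_pos β).ne'
  have htop : (multiFactorial β : ℝ≥0∞) ≠ ⊤ := ENNReal.natCast_ne_top _
  calc ∫⁻ t, ‖(monomial β t : ℂ) * chiHat (D.χ j a) t‖ₑ
      = (multiFactorial β : ℝ≥0∞) * (((multiFactorial β : ℝ≥0∞))⁻¹ *
          ∫⁻ t, ‖(monomial β t : ℂ) * chiHat (D.χ j a) t‖ₑ) := by
        rw [← mul_assoc, ENNReal.mul_inv_cancel h0 htop, one_mul]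
    _ ≤ (multiFactorial β : ℝ≥0∞) * ENNReal.ofReal (cst * D.S.M ^ ((j - 1) * multiDeg β)) :=
        mul_le_mul' le_rfl (by simpa only [enorm_eq_nnnorm] using h)

/-- The weighted kernel bound in the uniform shape used by the power counting: for `β ≤ δ` (so
`β! ≤ δ!`) and `M ≥ 1`, `β! · cst · M^{(j-1)|β|} ≤ δ! · max(1,cst) · M^{j|β|}`.
[cite: FeldmanKnorrerTrubowitz2004Ladders, Lemma II.16, proof (p.13 L86–106)] -/
theorem kernelBound_le_uniform {M cst : ℝ} (hM : 1 ≤ M) {j : ℕ} {β δ : Fin 3 → ℕ} (hβ : β ≤ δ) :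
    (multiFactorial β : ℝ≥0∞) * ENNReal.ofReal (cst * M ^ ((j - 1) * multiDeg β)) ≤
      (multiFactorial δ : ℝ≥0∞) * ENNReal.ofReal (max 1 cst) * ENNReal.ofReal (M ^ (j * multiDeg β)) := by
  have hF : (multiFactorial β : ℝ≥0∞) ≤ (multiFactorial δ : ℝ≥0∞) := by
    exact_mod_cast multiFactorial_le_of_le hβ
  have hM0 : 0 ≤ M := zero_le_one.trans hM
  have hpow : M ^ ((j - 1) * multiDeg β) ≤ M ^ (j * multiDeg β) :=
    pow_le_pow_right₀ hM (Nat.mul_le_mul_right _ (Nat.sub_le j 1))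
  have hreal : cst * M ^ ((j - 1) * multiDeg β) ≤ max 1 cst * M ^ (j * multiDeg β) := by
    rcases le_or_gt 0 cst with hc | hc
    · exact mul_le_mul (le_max_right _ _) hpow (pow_nonneg hM0 _) (le_trans zero_le_one (le_max_left _ _))
    · have : cst * M ^ ((j - 1) * multiDeg β) ≤ 0 :=
        mul_nonpos_of_nonpos_of_nonneg hc.le (pow_nonneg hM0 _)
      exact this.trans (mul_nonneg (le_trans zero_le_one (le_max_left _ _)) (pow_nonneg hM0 _))
  calc (multiFactorial β : ℝ≥0∞) * ENNReal.ofReal (cst * M ^ ((j - 1) * multiDeg β))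
      ≤ (multiFactorial δ : ℝ≥0∞) * ENNReal.ofReal (max 1 cst * M ^ (j * multiDeg β)) :=
        mul_le_mul' hF (ENNReal.ofReal_le_ofReal hreal)
    _ = _ := by
        rw [ENNReal.ofReal_mul (le_trans zero_le_one (le_max_left _ _)), mul_assoc]

/-- `|0| = 0`. [cite: FeldmanKnorrerTrubowitz2004Ladders, §I.5 (p.6 L131)] -/
theorem multiDeg_zero_index : multiDeg (0 : Fin 3 → ℕ) = 0 := by
  simp [multiDeg]

/-- **The power counting of p.13 L86–106** for the term labelled `σ_l, σ_c, σ_r`: the scale weights of the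
kernels plus the old scaled-norm exponent do not exceed the new scaled-norm exponent,
`Σ_ν j_ν|β_ν| + (ℓ'|α_l| + |α_c| max(ℓ',r') + r'|α_r|) ≤ ℓ|δ_l| + |δ_c| max(ℓ,r) + r|δ_r|`
(`j_ν = ℓ` on legs `0,1`, `r` on legs `2,3`; `ℓ' ≤ ℓ`, `r' ≤ r`).
[cite: FeldmanKnorrerTrubowitz2004Ladders, Lemma II.16, proof (p.13 L86–106)] -/
theorem powerCount_le {l l' r r' : ℕ} (hl : l' ≤ l) (hr : r' ≤ r) (δl δc δr : Fin 3 → ℕ)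
    {μ μ' : Fin 4} (hμ : μ = 0 ∨ μ = 1) (hμ' : μ' = 2 ∨ μ' = 3) (σl σc σr : Fin 3 → Fin 3) :
    (∑ ν : Fin 4, (if ν.val < 2 then l else r) * multiDeg (legIdx δl δc δr μ μ' σl σc σr ν)) +
        (l' * multiDeg (sel δl σl 1) + multiDeg (sel δc σc 1) * max l' r' +
          r' * multiDeg (sel δr σr 1)) ≤
      l * multiDeg δl + multiDeg δc * max l r + r * multiDeg δr := by
  -- decompose `|δ_•|` along the choice functions
  have hdl : multiDeg δl = multiDeg (sel δl σl 0) + multiDeg (sel δl σl 1) + multiDeg (sel δl σl 2) := by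
    conv_lhs => rw [← sel_sum δl σl]
    rw [multiDeg_add, multiDeg_add]
  have hdc : multiDeg δc = multiDeg (sel δc σc 0) + multiDeg (sel δc σc 1) + multiDeg (sel δc σc 2) := by
    conv_lhs => rw [← sel_sum δc σc]
    rw [multiDeg_add, multiDeg_add]
  have hdr : multiDeg δr = multiDeg (sel δr σr 0) + multiDeg (sel δr σr 1) + multiDeg (sel δr σr 2) := by
    conv_lhs => rw [← sel_sum δr σr]
    rw [multiDeg_add, multiDeg_add]
  have hmax1 : l ≤ max l r := le_max_left _ _
  have hmax2 : r ≤ max l r := le_max_right _ _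
  have hmax3 : max l' r' ≤ max l r := max_le_max hl hr
  have k1 := Nat.mul_le_mul_right (multiDeg (sel δl σl 1)) hl
  have k2 := Nat.mul_le_mul_left (multiDeg (sel δc σc 0)) hmax1
  have k3 := Nat.mul_le_mul_left (multiDeg (sel δc σc 1)) hmax3
  have k4 := Nat.mul_le_mul_left (multiDeg (sel δc σc 2)) hmax2
  have k5 := Nat.mul_le_mul_right (multiDeg (sel δr σr 1)) hr
  simp only [Fin.sum_univ_four, legIdx]
  rcases hμ with rfl | rfl <;> rcases hμ' with rfl | rfl <;>
    simp [multiDeg_add] <;> rw [hdl, hdc, hdr] <;> linarith [k1, k2, k3, k4, k5]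


/-- The kernel multi-indices of the splitting are dominated by `δ_l + δ_c + δ_r` (each leg receives at
most one piece from each of the three operators). [cite: FeldmanKnorrerTrubowitz2004Ladders, Lemma II.16, proof (p.13 L73–85)] -/
theorem legIdx_le_sum (δl δc δr : Fin 3 → ℕ) {μ μ' : Fin 4} (hμ : μ = 0 ∨ μ = 1)
    (hμ' : μ' = 2 ∨ μ' = 3) (σl σc σr : Fin 3 → Fin 3) (ν : Fin 4) :
    legIdx δl δc δr μ μ' σl σc σr ν ≤ δl + δc + δr := by
  intro c
  simp only [legIdx, Pi.add_apply]
  rcases hμ with rfl | rfl <;> rcases hμ' with rfl | rfl <;> fin_cases ν <;> simp [sel] <;>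
    split_ifs <;> omega

/-- In a real field: `A + E_old ≤ E_new` and `M ≥ 1` give `M^{-E_new} · M^{A} ≤ M^{-E_old}`.
[cite: FeldmanKnorrerTrubowitz2004Ladders, Lemma II.16, proof (p.13 L97–106)] -/
theorem inv_pow_mul_pow_le {M : ℝ} (hM : 1 ≤ M) {A Eold Enew : ℕ} (h : A + Eold ≤ Enew) :
    (M ^ Enew)⁻¹ * M ^ A ≤ (M ^ Eold)⁻¹ := by
  have hM0 : 0 < M := lt_of_lt_of_le zero_lt_one hM
  rw [inv_mul_le_iff₀ (pow_pos hM0 _), le_mul_inv_iff₀ (pow_pos hM0 _), ← pow_add]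
  exact pow_le_pow_right₀ hM h

/-- **One term of the splitting, integrated over a slice and scaled** (p.13 L58–106 for fixed
`s, s', σ⃗, μ, μ'`): `M^{-(ℓ|δ_l|+|δ_c|max(ℓ,r)+r|δ_r|)} ∫_{slice} convMajor_σ ≤ (δ⃗! · max(1,cst))⁴ ·
max_{α⃗ ≤ δ⃗} M^{-(ℓ'|α_l|+|α_c|max(ℓ',r')+r'|α_r|)} ‖f|_i‖^{(α⃗)}_{Σ_ℓ',Σ_r'}` — Step 3 of the core
file for the weighted kernels and function, the weighted kernel bound `‖x^β χ̂_s‖_{L¹} ≤ β! cst M^{(j-1)|β|}`,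
and the power counting `powerCount_le`. [cite: FeldmanKnorrerTrubowitz2004Ladders, Lemma II.16, proof (p.13 L58–106)] -/
theorem scaled_term_le (D : LadderData) {cst : ℝ} (hχ : ChiDecayBound D cst) (hM : 1 ≤ D.S.M)
    {l l' r r' : ℕ} (hl' : 1 ≤ l') (hl : l' ≤ l) (hr' : 1 ≤ r') (hr : r' ≤ r)
    (i : LegKind) (hall : ∀ ν, i ν = 1)
    (f : FourLegFn) (hf : ∀ s' : Fin 4 → Arc, Measurable fun y : Fin 4 → SpT => f i y s')
    (δl δc δr : Fin 3 → ℕ) (hδ : δl + δc + δr ∈ DeltaSet D.re D.r0)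
    (s s' : Fin 4 → Arc) (hs : AdmissibleLabels (D.Sig l) (D.Sig r) i s)
    (hs' : AdmissibleLabels (D.Sig l') (D.Sig r') i s')
    {μ μ' : Fin 4} (hμ : μ = 0 ∨ μ = 1) (hμ' : μ' = 2 ∨ μ' = 3)
    (k : Fin 4 → SpT) (μ₀ : Fin 4) (x₀ : SpT) (σl σc σr : Fin 3 → Fin 3) :
    ENNReal.ofReal ((D.S.M ^ (l * multiDeg δl + multiDeg δc * max l r + r * multiDeg δr))⁻¹) *
      ∫⁻ x : ({ν : Fin 4 // i ν = 1 ∧ ν ≠ μ₀} → SpT),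
        convMajor (fun ν : Fin 4 => i ν = 1 ∧ ((ν.val < 2 ∧ l ≠ l') ∨ (2 ≤ ν.val ∧ r ≠ r')))
          (fun ν t => (monomial (legIdx δl δc δr μ μ' σl σc σr ν.1) t : ℂ) *
            chiHat (D.χ (if ν.1.val < 2 then l else r) (s ν.1)) t)
          (fun ν => (-1 : ℝ) ^ bExp ν.1)
          (fun x => (pairWeight (sel δl σl 1) (sel δc σc 1) (sel δr σr 1) μ μ' x : ℂ) * f i x s')
          (legIns i k μ₀ x₀ x) ≤
      ((multiFactorial (δl + δc + δr) : ℝ≥0∞) * ENNReal.ofReal (max 1 cst)) ^ 4 *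
        ⨆ (αl : Fin 3 → ℕ) (_ : αl ≤ δl), ⨆ (αc : Fin 3 → ℕ) (_ : αc ≤ δc),
          ⨆ (αr : Fin 3 → ℕ) (_ : αr ≤ δr),
            ENNReal.ofReal
                ((D.S.M ^ (l' * multiDeg αl + multiDeg αc * max l' r' + r' * multiDeg αr))⁻¹) *
              legNorm (D.Sig l') (D.Sig r') i αl αc αr (f i) := by
  -- names
  set Enew := l * multiDeg δl + multiDeg δc * max l r + r * multiDeg δr with hEnew
  set αl := sel δl σl 1 with hαl
  set αc := sel δc σc 1 with hαc
  set αr := sel δr σr 1 with hαr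
  set Eold := l' * multiDeg αl + multiDeg αc * max l' r' + r' * multiDeg αr with hEold
  set F : ℝ≥0∞ := (multiFactorial (δl + δc + δr) : ℝ≥0∞) with hF
  set c₁ : ℝ≥0∞ := ENNReal.ofReal (max 1 cst) with hc₁
  set R := ⨆ (αl : Fin 3 → ℕ) (_ : αl ≤ δl), ⨆ (αc : Fin 3 → ℕ) (_ : αc ≤ δc),
    ⨆ (αr : Fin 3 → ℕ) (_ : αr ≤ δr),
      ENNReal.ofReal ((D.S.M ^ (l' * multiDeg αl + multiDeg αc * max l' r' + r' * multiDeg αr))⁻¹) *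
        legNorm (D.Sig l') (D.Sig r') i αl αc αr (f i) with hR
  have hF1 : 1 ≤ F := by
    rw [hF]; exact_mod_cast multiFactorial_pos _
  have hc₁1 : 1 ≤ c₁ := by
    rw [hc₁, ← ENNReal.ofReal_one]; exact ENNReal.ofReal_le_ofReal (le_max_left _ _)
  have hFc1 : 1 ≤ F * c₁ := one_le_mul hF1 hc₁1
  have hM0 : 0 < D.S.M := lt_of_lt_of_le zero_lt_one hM
  -- measurability of the weighted kernels and function
  have hKm : ∀ ν : {ν : Fin 4 // i ν = 1 ∧ ((ν.val < 2 ∧ l ≠ l') ∨ (2 ≤ ν.val ∧ r ≠ r'))},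
      Measurable fun t => (monomial (legIdx δl δc δr μ μ' σl σc σr ν.1) t : ℂ) *
        chiHat (D.χ (if ν.1.val < 2 then l else r) (s ν.1)) t :=
    fun ν => measurable_monomial_mul (measurable_chiHat _) _
  have hgm : Measurable fun x => (pairWeight αl αc αr μ μ' x : ℂ) * f i x s' :=
    measurable_pairWeight_mul (hf s') _ _ _ μ μ'
  -- Step 3 of the core file
  refine (mul_le_mul' le_rfl (lintegral_convMajor_legIns_le i (fun ν h => h.1) _ hKm _
    (fun ν => neg_one_pow_bExp ν.1) _ hgm k μ₀ x₀)).trans ?_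
  -- (a) the slice supremum of the weighted function is dominated by the old norm at `α⃗`
  have hS : (⨆ t : SpT, ∫⁻ x : ({ν : Fin 4 // i ν = 1 ∧ ν ≠ μ₀} → SpT),
      ‖(fun x => (pairWeight αl αc αr μ μ' x : ℂ) * f i x s') (legIns i k μ₀ t x)‖ₑ) ≤
      legNorm (D.Sig l') (D.Sig r') i αl αc αr (f i) := by
    unfold legNorm
    refine le_iSup₂_of_le s' hs' (le_iSup_of_le k (le_iSup₂_of_le μ hμ (le_iSup₂_of_le μ' hμ' ?_)))
    rw [diffDecay_triple_of_pos i (hall 0) (hall 1) (hall 2) (hall 3) μ μ' (hall μ) (hall μ') αl αc αr,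
      l1linfLegs_eq_iSup i _ k ⟨μ₀, hall μ₀⟩]
    refine le_iSup_of_le ⟨μ₀, hall μ₀⟩ (le_of_eq ?_)
    rfl
  -- (b) the weighted kernels
  have hK : ∀ ν : {ν : Fin 4 // i ν = 1 ∧ ((ν.val < 2 ∧ l ≠ l') ∨ (2 ≤ ν.val ∧ r ≠ r'))},
      ∫⁻ t, ‖(monomial (legIdx δl δc δr μ μ' σl σc σr ν.1) t : ℂ) *
          chiHat (D.χ (if ν.1.val < 2 then l else r) (s ν.1)) t‖ₑ ≤
        F * c₁ * ENNReal.ofReal (D.S.M ^ ((if ν.1.val < 2 then l else r) *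
          multiDeg (legIdx δl δc δr μ μ' σl σc σr ν.1))) := by
    intro ν
    have h1 := (hs ν.1).1 ν.2.1
    have hsc : 1 ≤ (if ν.1.val < 2 then l else r) ∧
        s ν.1 ∈ D.Sig (if ν.1.val < 2 then l else r) := by
      split_ifs with hlt
      · exact ⟨hl'.trans hl, h1.1 hlt⟩
      · exact ⟨hr'.trans hr, h1.2 (by omega)⟩
    have hβ : legIdx δl δc δr μ μ' σl σc σr ν.1 ≤ δl + δc + δr := legIdx_le_sum δl δc δr hμ hμ' σl σc σr ν.1
    exact (lintegral_enorm_monomial_chiHat_le hχ hsc.1 hsc.2 (mem_DeltaSet_of_le hβ hδ)).trans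
      (kernelBound_le_uniform hM hβ)
  have hKprod : (∏ ν : {ν : Fin 4 // i ν = 1 ∧ ((ν.val < 2 ∧ l ≠ l') ∨ (2 ≤ ν.val ∧ r ≠ r'))},
      ∫⁻ t, ‖(monomial (legIdx δl δc δr μ μ' σl σc σr ν.1) t : ℂ) *
          chiHat (D.χ (if ν.1.val < 2 then l else r) (s ν.1)) t‖ₑ) ≤
      (F * c₁) ^ 4 * ENNReal.ofReal (D.S.M ^ (∑ ν : Fin 4,
        (if ν.val < 2 then l else r) * multiDeg (legIdx δl δc δr μ μ' σl σc σr ν))) := by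
    refine (Finset.prod_le_prod' fun ν _ => hK ν).trans ?_
    rw [Finset.prod_mul_distrib, Finset.prod_const, Finset.card_univ,
      ← ENNReal.ofReal_prod_of_nonneg (fun _ _ => pow_nonneg hM0.le _), Finset.prod_pow_eq_pow_sum]
    refine mul_le_mul' (pow_le_pow_right₀ hFc1 ((Fintype.card_subtype_le _).trans (by simp)))
      (ENNReal.ofReal_le_ofReal (pow_le_pow_right₀ hM ?_))
    -- the sum over the convolved legs is at most the sum over all legs
    have hsub := Finset.sum_le_univ_sum_of_nonneg (s := Finset.univ.filter
      (fun ν : Fin 4 => i ν = 1 ∧ ((ν.val < 2 ∧ l ≠ l') ∨ (2 ≤ ν.val ∧ r ≠ r'))))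
      (f := fun ν : Fin 4 => (if ν.val < 2 then l else r) * multiDeg (legIdx δl δc δr μ μ' σl σc σr ν))
      (fun _ => Nat.zero_le _)
    rw [Finset.sum_subtype (Finset.univ.filter
      (fun ν : Fin 4 => i ν = 1 ∧ ((ν.val < 2 ∧ l ≠ l') ∨ (2 ≤ ν.val ∧ r ≠ r'))))
      (p := fun ν : Fin 4 => i ν = 1 ∧ ((ν.val < 2 ∧ l ≠ l') ∨ (2 ≤ ν.val ∧ r ≠ r'))) (by simp)] at hsub
    exact hsub
  -- (c) the power counting
  have hpc : (∑ ν : Fin 4, (if ν.val < 2 then l else r) * multiDeg (legIdx δl δc δr μ μ' σl σc σr ν)) +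
      Eold ≤ Enew := powerCount_le hl hr δl δc δr hμ hμ' σl σc σr
  have hMpow : ENNReal.ofReal ((D.S.M ^ Enew)⁻¹) * ENNReal.ofReal (D.S.M ^ (∑ ν : Fin 4,
        (if ν.val < 2 then l else r) * multiDeg (legIdx δl δc δr μ μ' σl σc σr ν))) ≤
      ENNReal.ofReal ((D.S.M ^ Eold)⁻¹) := by
    rw [← ENNReal.ofReal_mul (inv_nonneg.2 (pow_nonneg hM0.le _))]
    exact ENNReal.ofReal_le_ofReal (inv_pow_mul_pow_le hM hpc)
  -- (d) the old term is one of the terms of `R`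
  have hRα : ENNReal.ofReal ((D.S.M ^ Eold)⁻¹) * legNorm (D.Sig l') (D.Sig r') i αl αc αr (f i) ≤ R := by
    rw [hR]
    exact le_iSup₂_of_le αl (sel_le δl σl 1) (le_iSup₂_of_le αc (sel_le δc σc 1)
      (le_iSup₂_of_le αr (sel_le δr σr 1) le_rfl))
  -- assemble
  calc ENNReal.ofReal ((D.S.M ^ Enew)⁻¹) *
        ((∏ ν : {ν : Fin 4 // i ν = 1 ∧ ((ν.val < 2 ∧ l ≠ l') ∨ (2 ≤ ν.val ∧ r ≠ r'))},
          ∫⁻ t, ‖(monomial (legIdx δl δc δr μ μ' σl σc σr ν.1) t : ℂ) *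
            chiHat (D.χ (if ν.1.val < 2 then l else r) (s ν.1)) t‖ₑ) *
          ⨆ t : SpT, ∫⁻ x : ({ν : Fin 4 // i ν = 1 ∧ ν ≠ μ₀} → SpT),
            ‖(fun x => (pairWeight αl αc αr μ μ' x : ℂ) * f i x s') (legIns i k μ₀ t x)‖ₑ)
      ≤ ENNReal.ofReal ((D.S.M ^ Enew)⁻¹) *
          (((F * c₁) ^ 4 * ENNReal.ofReal (D.S.M ^ (∑ ν : Fin 4,
            (if ν.val < 2 then l else r) * multiDeg (legIdx δl δc δr μ μ' σl σc σr ν)))) *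
            legNorm (D.Sig l') (D.Sig r') i αl αc αr (f i)) :=
        mul_le_mul' le_rfl (mul_le_mul' hKprod hS)
    _ = (F * c₁) ^ 4 * ((ENNReal.ofReal ((D.S.M ^ Enew)⁻¹) * ENNReal.ofReal (D.S.M ^ (∑ ν : Fin 4,
            (if ν.val < 2 then l else r) * multiDeg (legIdx δl δc δr μ μ' σl σc σr ν)))) *
          legNorm (D.Sig l') (D.Sig r') i αl αc αr (f i)) := by ring
    _ ≤ (F * c₁) ^ 4 * (ENNReal.ofReal ((D.S.M ^ Eold)⁻¹) *
          legNorm (D.Sig l') (D.Sig r') i αl αc αr (f i)) :=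
        mul_le_mul' le_rfl (mul_le_mul' hMpow le_rfl)
    _ ≤ (F * c₁) ^ 4 * R := mul_le_mul' le_rfl hRα


/-- **Lemma II.16 (`\lemLADresectornorm`) for the all-position component, at every `δ⃗ ∈ Δ⃗`** — the
case "`i₁ = i₂ = i₃ = i₄ = 1`" that the printed proof displays (p.13 L37–114), modulo the sector
geometry exactly as in `legNorm_resectFour_le_of_neighbours` (neighbour map `N` with at most three old
labels per leg and new label, outside of which the resectorization summands vanish) and for components
measurable in their continuous arguments.  Conclusion, with `E(ℓ,r;δ⃗) = ℓ|δ_l| + |δ_c| max(ℓ,r) + r|δ_r|`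
the exponent of Definition II.13:
`M^{-E(ℓ,r;δ⃗)} ‖(f_{Σ_ℓ,Σ_r})|_i‖^{(δ⃗)}_{Σ_ℓ,Σ_r} ≤ C · max_{α⃗ ≤ δ⃗} M^{-E(ℓ',r';α⃗)} ‖f|_i‖^{(α⃗)}_{Σ_ℓ',Σ_r'}`,
`C = 3^{13+|δ⃗|} (δ⃗!)⁴ max(1,cst)⁴` depending only on `δ⃗` and the constant of `ChiDecayBound` — uniform
in `M ≥ 1` and in the scales, as printed ("the constant depends only on `Δ`").  Ingredients: on position
legs the differential–decay operators are multiplication operators (`diffDecay_triple_of_pos`), the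
weight splits along `x_ν - x_{ν'} = (x_ν - x'_ν) + (x'_ν - x'_{ν'}) + (x'_{ν'} - x_{ν'})`
(`abs_pairWeight_le`, replacing Leibniz's rule), each of the `27³` pieces is a leg-wise convolution
majorant with kernels `x^{β_ν} χ̂_{s_ν}` and the weighted function `(x'-differences)^{α⃗} f`
(`enorm_pairWeight_mul_convTerm_le`), Step 3 of the core file, `‖x^β χ̂_s‖_{L¹} ≤ β! cst M^{(j-1)|β|}`
(`ChiDecayBound`), and the power counting `powerCount_le`.  The momentum-leg components at `δ⃗ ≠ 0`
(genuine derivatives) are not treated. [cite: FeldmanKnorrerTrubowitz2004Ladders, Lemma II.16 (p.13 L19–33), proof p.13 L37–114] -/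
theorem scaledLegNorm_resectFour_allPos_le (D : LadderData) {cst : ℝ} (hχ : ChiDecayBound D cst)
    (hM : 1 ≤ D.S.M) {l l' r r' : ℕ} (hl' : 1 ≤ l') (hl : l' ≤ l) (hr' : 1 ≤ r') (hr : r' ≤ r)
    (i : LegKind) (hall : ∀ ν, i ν = 1)
    (f : FourLegFn) (hf : ∀ s' : Fin 4 → Arc, Measurable fun y : Fin 4 → SpT => f i y s')
    (N : Fin 4 → Arc → Finset Arc) (hN : ∀ μ a, (N μ a).card ≤ 3)
    (hvan : ∀ s s' : Fin 4 → Arc, AdmissibleLabels (D.Sig l) (D.Sig r) i s →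
      AdmissibleLabels (D.Sig l') (D.Sig r') i s' →
      (∃ μ : Fin 4, (i μ = 1 ∧ ((μ.val < 2 ∧ l ≠ l') ∨ (2 ≤ μ.val ∧ r ≠ r'))) ∧ s' μ ∉ N μ (s μ)) →
      ∀ y, resectTerm D l' r' l r f i s s' y = 0)
    (δl δc δr : Fin 3 → ℕ) (hδ : δl + δc + δr ∈ DeltaSet D.re D.r0) :
    ENNReal.ofReal ((D.S.M ^ (l * multiDeg δl + multiDeg δc * max l r + r * multiDeg δr))⁻¹) *
        legNorm (D.Sig l) (D.Sig r) i δl δc δr (resectFour D l' r' l r f i) ≤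
      3 ^ (13 + (multiDeg δl + multiDeg δc + multiDeg δr)) *
        ((multiFactorial (δl + δc + δr) : ℝ≥0∞) * ENNReal.ofReal (max 1 cst)) ^ 4 *
        ⨆ (αl : Fin 3 → ℕ) (_ : αl ≤ δl), ⨆ (αc : Fin 3 → ℕ) (_ : αc ≤ δc),
          ⨆ (αr : Fin 3 → ℕ) (_ : αr ≤ δr),
            ENNReal.ofReal
                ((D.S.M ^ (l' * multiDeg αl + multiDeg αc * max l' r' + r' * multiDeg αr))⁻¹) *
              legNorm (D.Sig l') (D.Sig r') i αl αc αr (f i) := by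
  set R := ⨆ (αl : Fin 3 → ℕ) (_ : αl ≤ δl), ⨆ (αc : Fin 3 → ℕ) (_ : αc ≤ δc),
    ⨆ (αr : Fin 3 → ℕ) (_ : αr ≤ δr),
      ENNReal.ofReal ((D.S.M ^ (l' * multiDeg αl + multiDeg αc * max l' r' + r' * multiDeg αr))⁻¹) *
        legNorm (D.Sig l') (D.Sig r') i αl αc αr (f i) with hR
  set Cst : ℝ≥0∞ :=
    ENNReal.ofReal ((D.S.M ^ (l * multiDeg δl + multiDeg δc * max l r + r * multiDeg δr))⁻¹) with hCst
  set K4 : ℝ≥0∞ := ((multiFactorial (δl + δc + δr) : ℝ≥0∞) * ENNReal.ofReal (max 1 cst)) ^ 4 with hK4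
  set Dg := multiDeg δl + multiDeg δc + multiDeg δr with hDg
  have hdd : ∀ (μ μ' : Fin 4) (g : (Fin 4 → SpT) → ℂ),
      diffDecay i 0 1 δl (diffDecay i μ μ' δc (diffDecay i 2 3 δr g)) =
        fun y => (pairWeight δl δc δr μ μ' y : ℂ) * g y := by
    intro μ μ' g
    rw [diffDecay_triple_of_pos i (hall 0) (hall 1) (hall 2) (hall 3) μ μ' (hall μ) (hall μ')]
    rfl
  unfold legNorm
  simp only [hdd, ENNReal.mul_iSup]
  refine iSup₂_le fun s hs => iSup_le fun k => iSup₂_le fun μ hμ => iSup₂_le fun μ' hμ' => ?_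
  rw [l1linfLegs_eq_iSup i _ k ⟨0, hall 0⟩]
  simp only [ENNReal.mul_iSup]
  refine iSup_le fun μ₀ => iSup_le fun x₀ => ?_
  -- the terms of the splitting, as functions of `y`
  set T : (Fin 4 → Arc) → (Fin 3 → Fin 3) → (Fin 3 → Fin 3) → (Fin 3 → Fin 3) →
      (Fin 4 → SpT) → ℝ≥0∞ := fun s' σl σc σr y =>
    convMajor (fun ν : Fin 4 => i ν = 1 ∧ ((ν.val < 2 ∧ l ≠ l') ∨ (2 ≤ ν.val ∧ r ≠ r')))
      (fun ν t => (monomial (legIdx δl δc δr μ μ' σl σc σr ν.1) t : ℂ) *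
        chiHat (D.χ (if ν.1.val < 2 then l else r) (s ν.1)) t)
      (fun ν => (-1 : ℝ) ^ bExp ν.1)
      (fun x => (pairWeight (sel δl σl 1) (sel δc σc 1) (sel δr σr 1) μ μ' x : ℂ) * f i x s') y
    with hT
  have hTm : ∀ s' σl σc σr, Measurable fun x : {ν : Fin 4 // i ν = 1 ∧ ν ≠ μ₀.1} → SpT =>
      T s' σl σc σr (legIns i k μ₀.1 x₀ x) := by
    intro s' σl σc σr
    exact (measurable_convMajor _ (fun ν => measurable_monomial_mul (measurable_chiHat _) _) _ _
      (measurable_pairWeight_mul (hf s') _ _ _ μ μ')).comp (measurable_legIns i k μ₀.1 x₀)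
  -- the boxes of old labels (as in the core file)
  set oldBox : Fin 4 → Finset Arc := fun μ =>
    if i μ = 1 ∧ ((μ.val < 2 ∧ l ≠ l') ∨ (2 ≤ μ.val ∧ r ≠ r'))
    then (if μ.val < 2 then D.Sig l' else D.Sig r') else {s μ} with holdBox
  set redBox : Fin 4 → Finset Arc := fun μ =>
    if i μ = 1 ∧ ((μ.val < 2 ∧ l ≠ l') ∨ (2 ≤ μ.val ∧ r ≠ r'))
    then (if μ.val < 2 then D.Sig l' else D.Sig r') ∩ N μ (s μ) else {s μ} with hredBox
  have hsum : ∀ y, resectFour D l' r' l r f i y s =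
      ∑ s' ∈ Fintype.piFinset oldBox, resectTerm D l' r' l r f i s s' y :=
    fun y => resectFour_eq_sum_resectTerm D l' r' l r f i y s
  have hsub : Fintype.piFinset redBox ⊆ Fintype.piFinset oldBox := by
    refine Fintype.piFinset_subset _ _ fun μ => ?_
    simp only [hredBox, holdBox]
    split_ifs <;> first
      | exact Finset.inter_subset_left
      | exact Finset.Subset.refl _
  have hadm_old : ∀ s' ∈ Fintype.piFinset oldBox, AdmissibleLabels (D.Sig l') (D.Sig r') i s' := by
    intro s' hs' μ
    rw [Fintype.mem_piFinset] at hs'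
    have hμ := hs' μ
    simp only [holdBox] at hμ
    refine ⟨fun hi1 => ?_, fun hi0 => ?_⟩
    · by_cases hc : (μ.val < 2 ∧ l ≠ l') ∨ (2 ≤ μ.val ∧ r ≠ r')
      · rw [if_pos ⟨hi1, hc⟩] at hμ
        refine ⟨fun hlt => ?_, fun hge => ?_⟩
        · simpa [hlt] using hμ
        · have hnlt : ¬ μ.val < 2 := by omega
          simpa [hnlt] using hμ
      · rw [if_neg (fun h => hc h.2), Finset.mem_singleton] at hμ
        rw [hμ]
        have h1 := (hs μ).1 hi1
        push Not at hc
        refine ⟨fun hlt => ?_, fun hge => ?_⟩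
        · rw [← hc.1 hlt]; exact h1.1 hlt
        · rw [← hc.2 hge]; exact h1.2 hge
    · have := hall μ
      omega
  have hcard : (Fintype.piFinset redBox).card ≤ 3 ^ 4 := by
    rw [Fintype.card_piFinset]
    have h3 : ∀ μ, (redBox μ).card ≤ 3 := by
      intro μ
      simp only [hredBox]
      split_ifs <;> first
        | exact (Finset.card_le_card Finset.inter_subset_right).trans (hN μ (s μ))
        | (rw [Finset.card_singleton]; omega)
    calc ∏ μ, (redBox μ).card ≤ ∏ _μ : Fin 4, 3 := Finset.prod_le_prod' fun μ _ => h3 μ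
      _ = 3 ^ 4 := by simp
  -- the pointwise bound: drop the vanishing summands, split the weight over the survivors
  have hpt : ∀ y : Fin 4 → SpT, ‖(pairWeight δl δc δr μ μ' y : ℂ) * resectFour D l' r' l r f i y s‖ₑ ≤
      ∑ s' ∈ Fintype.piFinset redBox, 3 ^ Dg *
        ∑ σl : Fin 3 → Fin 3, ∑ σc : Fin 3 → Fin 3, ∑ σr : Fin 3 → Fin 3, T s' σl σc σr y := by
    intro y
    rw [hsum y, ← Finset.sum_subset hsub ?_, Finset.mul_sum]
    · refine (enorm_sum_le _ _).trans (Finset.sum_le_sum fun s' _ => ?_)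
      rw [resectTerm_eq_convTerm]
      exact enorm_pairWeight_mul_convTerm_le _ (fun ν => measurable_chiHat _) _
        (fun ν => neg_one_pow_bExp ν.1) _ (hf s') δl δc δr hμ hμ' y
    · intro s' hs'old hs'red
      apply hvan s s' hs (hadm_old s' hs'old)
      rw [Fintype.mem_piFinset] at hs'old hs'red
      push Not at hs'red
      obtain ⟨ν, hν⟩ := hs'red
      have hνold := hs'old ν
      simp only [holdBox] at hνold
      simp only [hredBox] at hν
      by_cases hc : i ν = 1 ∧ ((ν.val < 2 ∧ l ≠ l') ∨ (2 ≤ ν.val ∧ r ≠ r'))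
      · rw [if_pos hc] at hνold hν
        exact ⟨ν, hc, fun hN' => hν (Finset.mem_inter.mpr ⟨hνold, hN'⟩)⟩
      · rw [if_neg hc] at hνold hν
        exact absurd hνold hν
  -- each scaled term is bounded by `K4 * R`
  have hterm : ∀ s' ∈ Fintype.piFinset redBox, ∀ σl σc σr : Fin 3 → Fin 3,
      Cst * ∫⁻ x : ({ν : Fin 4 // i ν = 1 ∧ ν ≠ μ₀.1} → SpT), T s' σl σc σr (legIns i k μ₀.1 x₀ x) ≤
        K4 * R :=
    fun s' hs' σl σc σr => scaled_term_le D hχ hM hl' hl hr' hr i hall f hf δl δc δr hδ s s' hs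
      (hadm_old s' (hsub hs')) hμ hμ' k μ₀.1 x₀ σl σc σr
  have h27 : (Fintype.card (Fin 3 → Fin 3) : ℝ≥0∞) = 3 ^ 3 := by
    rw [Fintype.card_fun, Fintype.card_fin]; norm_num
  -- integrate and sum up
  calc Cst * ∫⁻ x : ({ν : Fin 4 // i ν = 1 ∧ ν ≠ μ₀.1} → SpT),
        ‖(fun y => (pairWeight δl δc δr μ μ' y : ℂ) * resectFour D l' r' l r f i y s)
          (legIns i k μ₀.1 x₀ x)‖ₑ
      ≤ Cst * ∫⁻ x : ({ν : Fin 4 // i ν = 1 ∧ ν ≠ μ₀.1} → SpT),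
          ∑ s' ∈ Fintype.piFinset redBox, 3 ^ Dg *
            ∑ σl : Fin 3 → Fin 3, ∑ σc : Fin 3 → Fin 3, ∑ σr : Fin 3 → Fin 3,
              T s' σl σc σr (legIns i k μ₀.1 x₀ x) :=
        mul_le_mul' le_rfl (lintegral_mono fun x => hpt _)
    _ = Cst * ∑ s' ∈ Fintype.piFinset redBox, 3 ^ Dg *
          ∑ σl : Fin 3 → Fin 3, ∑ σc : Fin 3 → Fin 3, ∑ σr : Fin 3 → Fin 3,
            ∫⁻ x : ({ν : Fin 4 // i ν = 1 ∧ ν ≠ μ₀.1} → SpT), T s' σl σc σr (legIns i k μ₀.1 x₀ x) := by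
        congr 1
        have hm3 : ∀ s', Measurable fun x : {ν : Fin 4 // i ν = 1 ∧ ν ≠ μ₀.1} → SpT =>
            ∑ σl : Fin 3 → Fin 3, ∑ σc : Fin 3 → Fin 3, ∑ σr : Fin 3 → Fin 3,
              T s' σl σc σr (legIns i k μ₀.1 x₀ x) :=
          fun s' => Finset.measurable_sum _ fun σl _ => Finset.measurable_sum _ fun σc _ =>
            Finset.measurable_sum _ fun σr _ => hTm s' σl σc σr
        rw [lintegral_finsetSum _ fun s' _ => (hm3 s').const_mul _]
        refine Finset.sum_congr rfl fun s' _ => ?_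
        rw [lintegral_const_mul _ (hm3 s')]
        congr 1
        rw [lintegral_finsetSum _ fun σl _ => Finset.measurable_sum _ fun σc _ =>
          Finset.measurable_sum _ fun σr _ => hTm s' σl σc σr]
        refine Finset.sum_congr rfl fun σl _ => ?_
        rw [lintegral_finsetSum _ fun σc _ => Finset.measurable_sum _ fun σr _ => hTm s' σl σc σr]
        refine Finset.sum_congr rfl fun σc _ => ?_
        exact lintegral_finsetSum _ fun σr _ => hTm s' σl σc σr
    _ = ∑ s' ∈ Fintype.piFinset redBox, 3 ^ Dg *
          ∑ σl : Fin 3 → Fin 3, ∑ σc : Fin 3 → Fin 3, ∑ σr : Fin 3 → Fin 3,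
            Cst * ∫⁻ x : ({ν : Fin 4 // i ν = 1 ∧ ν ≠ μ₀.1} → SpT),
              T s' σl σc σr (legIns i k μ₀.1 x₀ x) := by
        rw [Finset.mul_sum]
        refine Finset.sum_congr rfl fun s' _ => ?_
        rw [mul_left_comm]
        refine congrArg (fun t : ℝ≥0∞ => (3 : ℝ≥0∞) ^ Dg * t) ?_
        rw [Finset.mul_sum]
        refine Finset.sum_congr rfl fun σl _ => ?_
        rw [Finset.mul_sum]
        refine Finset.sum_congr rfl fun σc _ => ?_
        rw [Finset.mul_sum]
    _ ≤ ∑ s' ∈ Fintype.piFinset redBox, 3 ^ Dg *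
          ∑ σl : Fin 3 → Fin 3, ∑ σc : Fin 3 → Fin 3, ∑ σr : Fin 3 → Fin 3, K4 * R := by
        refine Finset.sum_le_sum fun s' hs' => mul_le_mul' le_rfl ?_
        exact Finset.sum_le_sum fun σl _ => Finset.sum_le_sum fun σc _ =>
          Finset.sum_le_sum fun σr _ => hterm s' hs' σl σc σr
    _ = (Fintype.piFinset redBox).card * (3 ^ Dg * (3 ^ 3 * (3 ^ 3 * (3 ^ 3 * (K4 * R))))) := by
        simp only [Finset.sum_const, Finset.card_univ, nsmul_eq_mul, h27]
    _ ≤ 3 ^ 4 * (3 ^ Dg * (3 ^ 3 * (3 ^ 3 * (3 ^ 3 * (K4 * R))))) :=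
        mul_le_mul' (by exact_mod_cast hcard) le_rfl
    _ = 3 ^ (13 + Dg) * K4 * R := by ring


/-! ### §E With the sector count of `FKTLaddersSectorCounting`: modulo support vanishing only -/

/-- **Lemma II.16 for the all-position component at every `δ⃗ ∈ Δ⃗`, modulo the Fourier-support step
only.**  As `scaledLegNorm_resectFour_allPos_le`, for admissible ladder data (so `M > 1`), with the
neighbour map instantiated by the sector count `card_filter_extSector_inter_nonempty_le_three` of
`FKTLaddersSectorCounting` (at most three old extended sectors meet a new one): the only remaining
hypothesis besides measurability is that the `s'`-summand `resectTerm` vanishes identically when, on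
some position leg that changes scale, the new and old extended sectors are disjoint ("because `f` is
sectorized", p.13 L48–53). [cite: FeldmanKnorrerTrubowitz2004Ladders, Lemma II.16 (p.13 L19–33), proof p.13 L37–114] -/
theorem scaledLegNorm_resectFour_allPos_le_of_support (D : LadderData) (hD : D.Admissible)
    {cst : ℝ} (hχ : ChiDecayBound D cst) {l l' r r' : ℕ} (hl' : 1 ≤ l') (hl : l' ≤ l)
    (hr' : 1 ≤ r') (hr : r' ≤ r) (i : LegKind) (hall : ∀ ν, i ν = 1) (f : FourLegFn)
    (hf : ∀ s' : Fin 4 → Arc, Measurable fun y : Fin 4 → SpT => f i y s')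
    (hsupp : ∀ (s s' : Fin 4 → Arc) (μ : Fin 4),
      AdmissibleLabels (D.Sig l) (D.Sig r) i s → AdmissibleLabels (D.Sig l') (D.Sig r') i s' →
      ((μ.val < 2 ∧ l ≠ l') ∨ (2 ≤ μ.val ∧ r ≠ r')) →
      ¬ (extSector D.S D.e D.fr (if μ.val < 2 then l else r) (s μ) ∩
          extSector D.S D.e D.fr (if μ.val < 2 then l' else r') (s' μ)).Nonempty →
      ∀ y, resectTerm D l' r' l r f i s s' y = 0)
    (δl δc δr : Fin 3 → ℕ) (hδ : δl + δc + δr ∈ DeltaSet D.re D.r0) :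
    ENNReal.ofReal ((D.S.M ^ (l * multiDeg δl + multiDeg δc * max l r + r * multiDeg δr))⁻¹) *
        legNorm (D.Sig l) (D.Sig r) i δl δc δr (resectFour D l' r' l r f i) ≤
      3 ^ (13 + (multiDeg δl + multiDeg δc + multiDeg δr)) *
        ((multiFactorial (δl + δc + δr) : ℝ≥0∞) * ENNReal.ofReal (max 1 cst)) ^ 4 *
        ⨆ (αl : Fin 3 → ℕ) (_ : αl ≤ δl), ⨆ (αc : Fin 3 → ℕ) (_ : αc ≤ δc),
          ⨆ (αr : Fin 3 → ℕ) (_ : αr ≤ δr),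
            ENNReal.ofReal
                ((D.S.M ^ (l' * multiDeg αl + multiDeg αc * max l' r' + r' * multiDeg αr))⁻¹) *
              legNorm (D.Sig l') (D.Sig r') i αl αc αr (f i) := by
  classical
  -- the neighbour map: old sectors whose extension meets the extension of the new sector `a`
  let N : Fin 4 → Arc → Finset Arc := fun μ a =>
    if a ∈ D.Sig (if μ.val < 2 then l else r) then
      (if μ.val < 2 then D.Sig l' else D.Sig r').filter fun b =>
        (extSector D.S D.e D.fr (if μ.val < 2 then l else r) a ∩
          extSector D.S D.e D.fr (if μ.val < 2 then l' else r') b).Nonempty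
    else ∅
  refine scaledLegNorm_resectFour_allPos_le D hχ hD.scale.one_lt_M.le hl' hl hr' hr i hall f hf N
    ?_ ?_ δl δc δr hδ
  · intro μ a
    by_cases ha : a ∈ D.Sig (if μ.val < 2 then l else r)
    · simp only [N, if_pos ha]
      by_cases hμ : μ.val < 2
      · simp only [hμ, if_true] at ha ⊢
        exact card_filter_extSector_inter_nonempty_le_three D hD hl' hl ha
      · simp only [hμ, if_false] at ha ⊢
        exact card_filter_extSector_inter_nonempty_le_three D hD hr' hr ha
    · simp only [N, if_neg ha, Finset.card_empty]
      omega
  · rintro s s' hs hs' ⟨μ, ⟨hi1, hc⟩, hN⟩ y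
    refine hsupp s s' μ hs hs' hc ?_ y
    intro hne
    apply hN
    have hsμ : s μ ∈ D.Sig (if μ.val < 2 then l else r) := by
      have h1 := (hs μ).1 hi1
      split_ifs with hμ
      · exact h1.1 hμ
      · exact h1.2 (by omega)
    have hs'μ : s' μ ∈ (if μ.val < 2 then D.Sig l' else D.Sig r') := by
      have h1 := (hs' μ).1 hi1
      split_ifs with hμ
      · exact h1.1 hμ
      · exact h1.2 (by omega)
    simp only [N, if_pos hsμ]
    exact Finset.mem_filter.mpr ⟨hs'μ, hne⟩


/-! ### §F Finiteness of the old norm of the component gives slice integrability; the guarded form -/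

/-- Every slice integral of a component (labels admissible, momenta `k`, one position leg frozen at `t`)
is dominated by the component's `(0,0,0)`-coefficient norm `‖g‖^{(0,0,0)}_{Γ_l,Γ_r}` (Definition I.13 (i)).
[cite: FeldmanKnorrerTrubowitz2004Ladders, Definition I.13 (i) (p.7 L43–59)] -/
theorem lintegral_slice_le_legNorm_zero (Γl Γr : Finset Arc) (i : LegKind) (s' : Fin 4 → Arc)
    (hs' : AdmissibleLabels Γl Γr i s') (k : Fin 4 → SpT) (μ₀ : Fin 4) (hμ₀ : i μ₀ = 1) (t : SpT)
    (g : (Fin 4 → SpT) → (Fin 4 → Arc) → ℂ) :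
    ∫⁻ x : ({μ : Fin 4 // i μ = 1 ∧ μ ≠ μ₀} → SpT), ‖g (legIns i k μ₀ t x) s'‖ₑ ≤
      legNorm Γl Γr i 0 0 0 g := by
  unfold legNorm
  simp only [diffDecay_zero]
  refine le_iSup₂_of_le s' hs' (le_iSup_of_le k (le_iSup₂_of_le 0 (Or.inl rfl)
    (le_iSup₂_of_le 2 (Or.inl rfl) ?_)))
  rw [l1linfLegs_eq_iSup i _ k ⟨μ₀, hμ₀⟩]
  exact le_iSup_of_le ⟨μ₀, hμ₀⟩ (le_iSup_of_le t le_rfl)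

/-- The `α⃗ = 0` term of the scaled maximum: `‖f|_i‖^{(0,0,0)}` is dominated by
`max_{α⃗ ≤ δ⃗} M^{-E(ℓ',r';α⃗)} ‖f|_i‖^{(α⃗)}` (the weight of the `α⃗ = 0` term is `M^0 = 1`).
[cite: FeldmanKnorrerTrubowitz2004Ladders, Definition II.13 (p.12 L117–129)] -/
theorem legNorm_zero_le_iSup_scaled (D : LadderData) (l' r' : ℕ) (i : LegKind)
    (g : (Fin 4 → SpT) → (Fin 4 → Arc) → ℂ) (δl δc δr : Fin 3 → ℕ) :
    legNorm (D.Sig l') (D.Sig r') i 0 0 0 g ≤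
      ⨆ (αl : Fin 3 → ℕ) (_ : αl ≤ δl), ⨆ (αc : Fin 3 → ℕ) (_ : αc ≤ δc),
        ⨆ (αr : Fin 3 → ℕ) (_ : αr ≤ δr),
          ENNReal.ofReal
              ((D.S.M ^ (l' * multiDeg αl + multiDeg αc * max l' r' + r' * multiDeg αr))⁻¹) *
            legNorm (D.Sig l') (D.Sig r') i αl αc αr g := by
  refine le_iSup₂_of_le 0 bot_le (le_iSup₂_of_le 0 bot_le (le_iSup₂_of_le 0 bot_le ?_))
  simp [multiDeg_zero_index]

/-- **Slice integrability from finiteness, per component.**  If `‖f|_i‖^{(0,0,0)}_{Σ_ℓ',Σ_r'} < ∞` and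
`f|_i(·,s')` is measurable then every slice (one position leg frozen) is integrable — the premise
under which the support-vanishing step applies to this component.
[cite: FeldmanKnorrerTrubowitz2004Ladders, Definition I.13 (i) (p.7 L43–59) and Lemma II.16 (p.13 L19–33)] -/
theorem integrable_slice_of_legNorm_zero_ne_top (Γl Γr : Finset Arc) (i : LegKind)
    (g : (Fin 4 → SpT) → (Fin 4 → Arc) → ℂ) (hfin : legNorm Γl Γr i 0 0 0 g ≠ ⊤)
    (s' : Fin 4 → Arc) (hs' : AdmissibleLabels Γl Γr i s')
    (hg : Measurable fun y : Fin 4 → SpT => g y s') (k : Fin 4 → SpT) (μ₀ : Fin 4) (hμ₀ : i μ₀ = 1)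
    (t : SpT) :
    Integrable (fun x : ({μ : Fin 4 // i μ = 1 ∧ μ ≠ μ₀} → SpT) => g (legIns i k μ₀ t x) s') := by
  refine ⟨(hg.comp (measurable_legIns i k μ₀ t)).aestronglyMeasurable, ?_⟩
  exact lt_of_le_of_lt (lintegral_slice_le_legNorm_zero Γl Γr i s' hs' k μ₀ hμ₀ t g)
    (lt_top_iff_ne_top.2 hfin)

/-- **The all-position bound at every `δ⃗`, modulo support vanishing in the finite case only**: as
`scaledLegNorm_resectFour_allPos_le_of_support`, but the support input may assume
`‖f|_i‖^{(0,0,0)}_{Σ_ℓ',Σ_r'} < ∞` (hence slice integrability, `integrable_slice_of_legNorm_zero_ne_top`);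
if that norm is infinite the right-hand side is infinite and the bound is trivial.
[cite: FeldmanKnorrerTrubowitz2004Ladders, Lemma II.16 (p.13 L19–33), proof p.13 L37–114] -/
theorem scaledLegNorm_resectFour_allPos_le_of_support' (D : LadderData) (hD : D.Admissible)
    {cst : ℝ} (hχ : ChiDecayBound D cst) {l l' r r' : ℕ} (hl' : 1 ≤ l') (hl : l' ≤ l)
    (hr' : 1 ≤ r') (hr : r' ≤ r) (i : LegKind) (hall : ∀ ν, i ν = 1) (f : FourLegFn)
    (hf : ∀ s' : Fin 4 → Arc, Measurable fun y : Fin 4 → SpT => f i y s')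
    (hsupp : legNorm (D.Sig l') (D.Sig r') i 0 0 0 (f i) ≠ ⊤ → ∀ (s s' : Fin 4 → Arc) (μ : Fin 4),
      AdmissibleLabels (D.Sig l) (D.Sig r) i s → AdmissibleLabels (D.Sig l') (D.Sig r') i s' →
      ((μ.val < 2 ∧ l ≠ l') ∨ (2 ≤ μ.val ∧ r ≠ r')) →
      ¬ (extSector D.S D.e D.fr (if μ.val < 2 then l else r) (s μ) ∩
          extSector D.S D.e D.fr (if μ.val < 2 then l' else r') (s' μ)).Nonempty →
      ∀ y, resectTerm D l' r' l r f i s s' y = 0)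
    (δl δc δr : Fin 3 → ℕ) (hδ : δl + δc + δr ∈ DeltaSet D.re D.r0) :
    ENNReal.ofReal ((D.S.M ^ (l * multiDeg δl + multiDeg δc * max l r + r * multiDeg δr))⁻¹) *
        legNorm (D.Sig l) (D.Sig r) i δl δc δr (resectFour D l' r' l r f i) ≤
      3 ^ (13 + (multiDeg δl + multiDeg δc + multiDeg δr)) *
        ((multiFactorial (δl + δc + δr) : ℝ≥0∞) * ENNReal.ofReal (max 1 cst)) ^ 4 *
        ⨆ (αl : Fin 3 → ℕ) (_ : αl ≤ δl), ⨆ (αc : Fin 3 → ℕ) (_ : αc ≤ δc),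
          ⨆ (αr : Fin 3 → ℕ) (_ : αr ≤ δr),
            ENNReal.ofReal
                ((D.S.M ^ (l' * multiDeg αl + multiDeg αc * max l' r' + r' * multiDeg αr))⁻¹) *
              legNorm (D.Sig l') (D.Sig r') i αl αc αr (f i) := by
  by_cases htop : legNorm (D.Sig l') (D.Sig r') i 0 0 0 (f i) = ⊤
  · have hR : (⨆ (αl : Fin 3 → ℕ) (_ : αl ≤ δl), ⨆ (αc : Fin 3 → ℕ) (_ : αc ≤ δc),
        ⨆ (αr : Fin 3 → ℕ) (_ : αr ≤ δr),
          ENNReal.ofReal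
              ((D.S.M ^ (l' * multiDeg αl + multiDeg αc * max l' r' + r' * multiDeg αr))⁻¹) *
            legNorm (D.Sig l') (D.Sig r') i αl αc αr (f i)) = ⊤ :=
      eq_top_iff.2 (htop ▸ legNorm_zero_le_iSup_scaled D l' r' i (f i) δl δc δr)
    have hC : (3 ^ (13 + (multiDeg δl + multiDeg δc + multiDeg δr)) *
        ((multiFactorial (δl + δc + δr) : ℝ≥0∞) * ENNReal.ofReal (max 1 cst)) ^ 4 : ℝ≥0∞) ≠ 0 := by
      have hF : (multiFactorial (δl + δc + δr) : ℝ≥0∞) ≠ 0 := by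
        exact_mod_cast (multiFactorial_pos _).ne'
      have hc : ENNReal.ofReal (max 1 cst) ≠ 0 :=
        (ENNReal.ofReal_pos.2 (lt_of_lt_of_le zero_lt_one (le_max_left _ _))).ne'
      exact mul_ne_zero (pow_ne_zero _ (by norm_num)) (pow_ne_zero _ (mul_ne_zero hF hc))
    rw [hR, ENNReal.mul_top hC]
    exact le_top
  · exact scaledLegNorm_resectFour_allPos_le_of_support D hD hχ hl' hl hr' hr i hall f hf (hsupp htop)
      δl δc δr hδ

end FKTLadders

end Literature.MathematicalPhysics.QuantumLattice.FermiRG
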